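import Mathlib
import Literature.RingTheory.PBasis.KunzConjectureReduction
import Literature.AlgebraicGeometry.Resolution.KunzRegularityCriterionProofs
import Literature.AlgebraicGeometry.Resolution.PointBlowupHilbertSamuel
import Literature.RingTheory.CompleteLocalRings.CoefficientFieldCharP
import HarnessLib

/-!
# Kunz's conjecture (Kimura–Niitsuma 1982, THEOREM §3) in dimension `≤ 2` — PROVED

Topic: `Literature/RingTheory/PBasis`. Continuation of `KunzConjectureReduction` (which proves the THEOREM of
T. Kimura, H. Niitsuma, *On Kunz's conjecture*, J. Math. Soc. Japan 34 (1982) 371–378, from the content `h5`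
of their Lemma 5, and unconditionally in dimension `≤ 1`). Here the Lemma-5 input is PROVED for `dim R = 2`
(`RelativePBasis.lemma5_of_ringKrullDim_eq_two`), whence

* `RelativePBasis.exists_isPBasisOver_of_ringKrullDim_le_two` — **the Kimura–Niitsuma theorem, unconditional
  for regular local rings of dimension `≤ 2`**: a regular local ring `R` of characteristic `p` with
  `dim R ≤ 2`, module-finite over a regular local subring `R' ⊇ R^p`, has a `p`-basis over `R'` (any rank,
  any residue field). For `dim R = 2`, `k = k̄`, `R` complete this is R. Ganong's theorem on plane Frobenius
  sandwiches (proved there with Hamburger–Noether expansions); KN prove the general case through Lemma 5,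
  whose printed proof uses completion, `k̄`-base change and Harper's theorem on differentiably simple rings.

## Route (ours; the printed ingredients, assembled in the Artinian fibre instead of the completion)

For a pair `R ⊋ R' ⊇ R^p` (regular local, `R` finite over `R'`, same residue field) with `𝔪 = (x₁, …, x_n)`
minimally, put `𝔮 = (xᵢ^p) R'`, `P = R/𝔮R ⊇ A =` image of `R'` (`≅ R'/𝔮`, as `𝔮R ∩ R' = 𝔮` by faithful
flatness). Then:
* `P` is free over `A` of rank `rank_{R'} R` (an `R'`-basis of `R` reduces to an `A`-basis);
* `ℓ(P) = p^n` — Kunz 1969 / Stacks 0EC0 (flat Frobenius of the regular `R` and Lech's independence count),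
  tree `Kunz1969.length_quotient_frobeniusPower_eq`;
* `A` is Artinian local of characteristic `p`, hence complete, so it has a coefficient field `κ` (Cohen; tree
  `CompleteLocalRings.exists_ringHom_comp_residue_eq_id_of_charP`), which is one of `P` as well (`k = k'`);
  counting lengths over `κ`, `dim_κ P = p^n`, so `κ[X₁, …, X_n]/(Xᵢ^p) → P`, `Xᵢ ↦ x̄ᵢ` (onto: `P` is
  residually rational over `κ`, tree `top_le_sup_span_pow_sup_pow`) is an ISOMORPHISM;
* `κ[X]/(Xᵢ^p)` in characteristic `p` carries the partial derivatives `∂/∂Xᵢ`, and NO nonzero proper ideal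
  is stable under all of them (`TruncPoly.ideal_eq_top_of_forall_D_mem`: commuting nilpotent operators have a
  common zero in a stable ideal, and a common zero of all `∂/∂Xᵢ` is a constant) — this is the differential
  simplicity S. Yuan / KN use on p. 375–376;
* hence (`exists_pow_ne_zero_of_dsimple`, the trivial case of Harper's theorem): unless `𝔫_A = 0`, a
  component `∂` (in the `A`-basis of `P`) of some transported `∂/∂Xᵢ` is a derivation of `A` with `∂a` a
  unit for some `a ∈ 𝔫_A`, and `∂(a^{j+1}) = (j+1)a^j ∂a` gives `a^{p-1} ≠ 0`; as `a^p = 0`, the powers of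
  `a` are `κ`-independent, `dim_κ A ≥ p`;
* for `n = 2`: `dim_κ A · rank_{R'} R = p²` and `R' ≠ R` force `dim_κ A = p`, `A = κ[a]`, `𝔫_A = aA`,
  `𝔪' ⊆ yR' + 𝔮`; since `𝔪'` needs `dim R' = 2` generators (Nakayama), some `xᵢ^p ∉ 𝔪'²` — which is the
  Lemma-5 input. For `n ≥ 3` the same route needs Harper's theorem in dimension `p^{n-1}`:
* `RelativePBasis.lemma5_of_harper` / `RelativePBasis.kimuraNiitsuma1982_theorem_of_harper` (revision 2): the
  Lemma-5 input in every dimension, and the full theorem F-96h, from HARPER'S THEOREM as an explicit hypothesis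
  (consequence-form: a local Artinian `κ`-algebra with coefficient field `κ`, `𝔫^{[p]} = 0`, in which every nonzero
  proper ideal is moved by a `κ`-derivation, has `𝔫` generated by `e` elements with `p^e = dim_κ`); the component
  derivations are supplied by `RelativePBasis.exists_derivation_of_dsimple` (KN p. 375–376).

Not a statement of H. Hironaka's manuscript; settled 1982 mathematics. Resolution of singularities in positive
characteristic is not proved by any of this. Written by seat `res-B-lit-kn82` (literature-prover) of cell
res-hironaka for the INPUTS desk (F-96h, director order DR-IN14 (i)–(ii)).

## References
* T. Kimura, H. Niitsuma, *On Kunz's conjecture*, J. Math. Soc. Japan 34 (1982) 371–378: Lemma 5 p. 376,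
  finite case p. 375–376 (Yuan's differential-simplicity argument, Harper's theorem). [KimuraNiitsuma1982]
* R. Ganong, *Plane Frobenius sandwiches*, Proc. Amer. Math. Soc. 84 (1982) 474–478 (the dimension-2 statement
  over `k = k̄`; context). [Ganong1982]
* H. Matsumura, *Commutative Ring Theory*, CUP 1986, Thm. 27.3 (derivations with `Dx = 1` in
  characteristic `p`), §28 (coefficient fields). [Matsumura1987]
* The Stacks Project, Tag 0EC0 (Kunz's theorem; the length count `ℓ(A/(x₁^q, …, x_r^q)) = q^r`). [StacksProject]
-/

namespace Literature.RingTheory.PBasis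

/-! ## The truncated polynomial algebra `κ[X₁,…,Xₙ]/(Xᵢ^p)` and its partial derivatives -/

namespace TruncPoly

open _root_.MvPolynomial

universe u

variable {κ : Type u} [Field κ] {p : ℕ} [hp : Fact p.Prime] [CharP κ p] {n : ℕ}

variable (κ p n) in
/-- The ideal `(X₁^p, …, Xₙ^p)` of `κ[X₁, …, Xₙ]`. [folklore] -/
noncomputable def frobIdeal : Ideal (MvPolynomial (Fin n) κ) :=
  Ideal.span (Set.range fun i : Fin n => (X i : MvPolynomial (Fin n) κ) ^ p)

omit hp [CharP κ p] in
/-- `(Xᵢ^p)` as a monomial ideal. [folklore] -/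
private theorem frobIdeal_eq_span_monomial : frobIdeal κ p n =
    Ideal.span ((fun s => monomial s (1 : κ)) '' Set.range fun i : Fin n => Finsupp.single i p) := by
  unfold frobIdeal
  congr 1
  ext x
  simp only [Set.mem_range, Set.mem_image]
  constructor
  · rintro ⟨i, rfl⟩
    exact ⟨Finsupp.single i p, ⟨i, rfl⟩, by rw [X_pow_eq_monomial]⟩
  · rintro ⟨s, ⟨i, rfl⟩, rfl⟩
    exact ⟨i, by rw [X_pow_eq_monomial]⟩

omit hp [CharP κ p] in
/-- Membership in the monomial ideal `(Xᵢ^p)`: every monomial of the support has some exponent `≥ p`.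
[folklore] -/
private theorem mem_frobIdeal_iff {x : MvPolynomial (Fin n) κ} :
    x ∈ frobIdeal κ p n ↔ ∀ m ∈ x.support, ∃ i, p ≤ m i := by
  rw [frobIdeal_eq_span_monomial, mem_ideal_span_monomial_image]
  refine forall₂_congr fun m _ => ⟨?_, ?_⟩
  · rintro ⟨si, ⟨i, rfl⟩, hle⟩
    exact ⟨i, by simpa using hle i⟩
  · rintro ⟨i, hi⟩
    exact ⟨Finsupp.single i p, ⟨i, rfl⟩, Finsupp.single_le_iff.mpr (by simpa using hi)⟩

omit hp [CharP κ p] in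
/-- A truncated polynomial in `(Xᵢ^p)` vanishes. [folklore] -/
private theorem eq_zero_of_truncated_of_mem {x : MvPolynomial (Fin n) κ} (hx : ∀ m ∈ x.support, ∀ i, m i < p)
    (hI : x ∈ frobIdeal κ p n) : x = 0 := by
  rw [mem_frobIdeal_iff] at hI
  ext m
  rw [coeff_zero]
  by_contra h
  have hm : m ∈ x.support := by simpa using h
  obtain ⟨i, hi⟩ := hI m hm
  exact absurd (hx m hm i) (not_lt.mpr hi)

/-- The truncation of a polynomial: keep the monomials with all exponents `< p`. [folklore] -/
noncomputable def trunc (p : ℕ) (x : MvPolynomial (Fin n) κ) : MvPolynomial (Fin n) κ :=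
  ∑ m ∈ x.support with (∀ i, m i < p), monomial m (coeff m x)

omit hp [CharP κ p] in
/-- Coefficients of the truncation. [folklore] -/
private theorem coeff_trunc (x : MvPolynomial (Fin n) κ) (m : Fin n →₀ ℕ) :
    coeff m (trunc p x) = if (∀ i, m i < p) then coeff m x else 0 := by
  classical
  unfold trunc
  rw [coeff_sum]
  simp_rw [coeff_monomial]
  rw [Finset.sum_ite_eq' (x.support.filter _) m (fun j => coeff j x)]
  simp only [Finset.mem_filter, mem_support_iff, ne_eq]
  by_cases h : ∀ i, m i < p
  · by_cases h0 : coeff m x = 0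
    · simp [h, h0]
    · simp [h, h0]
  · simp [h]

omit hp [CharP κ p] in
/-- The truncation is truncated. [folklore] -/
private theorem truncated_trunc (x : MvPolynomial (Fin n) κ) : ∀ m ∈ (trunc p x).support, ∀ i, m i < p := by
  intro m hm i
  rw [mem_support_iff, coeff_trunc] at hm
  by_contra h
  exact hm (if_neg fun h' => h (h' i))

omit hp [CharP κ p] in
/-- `x - trunc x ∈ (Xᵢ^p)`. [folklore] -/
private theorem sub_trunc_mem (x : MvPolynomial (Fin n) κ) : x - trunc p x ∈ frobIdeal κ p n := by
  rw [mem_frobIdeal_iff]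
  intro m hm
  rw [mem_support_iff, coeff_sub, coeff_trunc] at hm
  by_contra h
  push Not at h
  exact hm (by rw [if_pos h, sub_self])

omit hp [CharP κ p] in
/-- Truncating a truncated polynomial does nothing. [folklore] -/
private theorem trunc_eq_self {x : MvPolynomial (Fin n) κ} (hx : ∀ m ∈ x.support, ∀ i, m i < p) : trunc p x = x := by
  ext m
  rw [coeff_trunc]
  by_cases h : ∀ i, m i < p
  · rw [if_pos h]
  · rw [if_neg h]
    by_contra h0
    exact h (hx m (by simpa [mem_support_iff] using Ne.symm h0))

omit hp [CharP κ p] in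
/-- `x` and its truncation agree in `κ[X]/(Xᵢ^p)`. [folklore] -/
private theorem mk_trunc (x : MvPolynomial (Fin n) κ) :
    Ideal.Quotient.mk (frobIdeal κ p n) (trunc p x) = Ideal.Quotient.mk (frobIdeal κ p n) x := by
  rw [eq_comm, Ideal.Quotient.mk_eq_mk_iff_sub_mem]
  exact sub_trunc_mem x

/-! ### Partial derivatives preserve `(Xᵢ^p)` in characteristic `p` -/

omit hp in
/-- `∂/∂Xᵢ` preserves `(Xᵢ^p)` in characteristic `p`. [folklore] -/
private theorem pderiv_mem_frobIdeal (i : Fin n) {x : MvPolynomial (Fin n) κ} (hx : x ∈ frobIdeal κ p n) :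
    pderiv i x ∈ frobIdeal κ p n := by
  unfold frobIdeal at hx ⊢
  induction hx using Submodule.span_induction with
  | mem x hx =>
    obtain ⟨j, rfl⟩ := hx
    have hp0 : ((p : ℕ) : MvPolynomial (Fin n) κ) = 0 := CharP.cast_eq_zero _ p
    rw [pderiv_pow, hp0, zero_mul, zero_mul]
    exact zero_mem _
  | zero => rw [map_zero]; exact zero_mem _
  | add x y _ _ hx hy => rw [map_add]; exact add_mem hx hy
  | smul a x hx ih =>
    rw [smul_eq_mul, pderiv_mul]
    exact add_mem (Ideal.mul_mem_left _ _ (by exact hx)) (Ideal.mul_mem_left _ _ ih)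

omit hp [CharP κ p] in
/-- Partial derivatives of truncated polynomials are truncated. [folklore] -/
private theorem truncated_pderiv (i : Fin n) {x : MvPolynomial (Fin n) κ} (hx : ∀ m ∈ x.support, ∀ i, m i < p) :
    ∀ m ∈ (pderiv i x).support, ∀ j, m j < p := by
  intro m hm j
  rw [mem_support_iff, coeff_pderiv] at hm
  have h1 : coeff (m + Finsupp.single i 1) x ≠ 0 := fun h => hm (by rw [h, zero_mul])
  have h2 := hx _ (mem_support_iff.mpr h1) j
  have : m j ≤ (m + Finsupp.single i 1 : Fin n →₀ ℕ) j := by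
    rw [Finsupp.add_apply]
    exact Nat.le_add_right _ _
  omega

/-- Iterated partial derivative of a monomial. [folklore] -/
private theorem iterate_pderiv_monomial (i : Fin n) (k : ℕ) (s : Fin n →₀ ℕ) (a : κ) :
    (pderiv i)^[k] (monomial s a) =
      monomial (s - Finsupp.single i k) (a * (Nat.descFactorial (s i) k : κ)) := by
  induction k with
  | zero =>
    rw [Function.iterate_zero, id_eq, Nat.descFactorial_zero, Nat.cast_one, mul_one, Finsupp.single_zero,
      tsub_zero]
  | succ k ih =>
    rw [Function.iterate_succ_apply', ih, pderiv_monomial, Nat.descFactorial_succ]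
    have h1 : (s - Finsupp.single i k - Finsupp.single i 1 : Fin n →₀ ℕ) =
        s - Finsupp.single i (k + 1) := by
      ext j
      rw [Finsupp.tsub_apply, Finsupp.tsub_apply, Finsupp.tsub_apply, Finsupp.single_apply,
        Finsupp.single_apply, Finsupp.single_apply]
      split_ifs <;> omega
    have h2 : (s - Finsupp.single i k : Fin n →₀ ℕ) i = s i - k := by
      rw [Finsupp.tsub_apply, Finsupp.single_eq_same]
    rw [h1, h2]
    congr 1
    push_cast
    ring

omit hp in
/-- In characteristic `p`, the `p`-th iterate of a partial derivative vanishes. [folklore] -/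
private theorem iterate_pderiv_prime_eq_zero (hp' : p.Prime) (i : Fin n) (x : MvPolynomial (Fin n) κ) :
    (pderiv i)^[p] x = 0 := by
  have key : ∀ x, ((pderiv i (R := κ) (σ := Fin n)).toLinearMap ^ p) x = (pderiv i)^[p] x :=
    fun x => Module.End.pow_apply _ _ _
  rw [← key]
  induction x using MvPolynomial.induction_on' with
  | monomial s a =>
    rw [key, iterate_pderiv_monomial]
    have hdvd : p ∣ (s i).descFactorial p := by
      rw [Nat.descFactorial_eq_factorial_mul_choose]
      exact dvd_mul_of_dvd_left (Nat.dvd_factorial hp'.pos le_rfl) _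
    have : ((Nat.descFactorial (s i) p : ℕ) : κ) = 0 := (CharP.cast_eq_zero_iff κ p _).mpr hdvd
    rw [this, mul_zero, monomial_zero]
  | add x y hx hy => rw [map_add, hx, hy, add_zero]

omit hp in
/-- A truncated polynomial all of whose partial derivatives vanish is a constant (exponents `< p`
are invertible in `κ`). [folklore] -/
private theorem eq_C_of_forall_pderiv_eq_zero {x : MvPolynomial (Fin n) κ} (hx : ∀ m ∈ x.support, ∀ i, m i < p)
    (h : ∀ i, pderiv i x = 0) : x = C (coeff 0 x) := by
  ext m
  rw [coeff_C]
  by_cases hm : 0 = m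
  · rw [if_pos hm, hm]
  · rw [if_neg hm]
    have hm' : m ≠ 0 := Ne.symm hm
    obtain ⟨i, hi⟩ : ∃ i, m i ≠ 0 := by
      by_contra hall
      push Not at hall
      exact hm' (Finsupp.ext hall)
    by_cases hsupp : m ∈ x.support
    · have hlt := hx m hsupp i
      have hc := coeff_pderiv (i := i) x (m - Finsupp.single i 1)
      rw [h i, coeff_zero, Finsupp.sub_add_single_one_cancel hi] at hc
      have hcast : (((m - Finsupp.single i 1 : Fin n →₀ ℕ) i : κ) + 1) ≠ 0 := by
        have heq : (m - Finsupp.single i 1 : Fin n →₀ ℕ) i + 1 = m i := by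
          rw [Finsupp.tsub_apply, Finsupp.single_eq_same]; omega
        have : (((m - Finsupp.single i 1 : Fin n →₀ ℕ) i + 1 : ℕ) : κ) ≠ 0 := by
          rw [heq, Ne, CharP.cast_eq_zero_iff κ p]
          intro hdvd
          exact absurd (Nat.le_of_dvd (Nat.pos_of_ne_zero hi) hdvd) (not_le.mpr hlt)
        exact_mod_cast this
      exact (mul_eq_zero.mp hc.symm).resolve_right hcast
    · simpa [mem_support_iff] using hsupp

/-! ### The derivations on the quotient `κ[X]/(Xᵢ^p)` -/

variable (κ p n) in
/-- The truncated polynomial algebra `κ[X₁, …, Xₙ]/(X₁^p, …, Xₙ^p)`. [folklore] -/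
abbrev Alg : Type u := MvPolynomial (Fin n) κ ⧸ frobIdeal κ p n

variable (κ p n) in
/-- The partial derivative `∂/∂Xᵢ` on `κ[X]/(Xᵢ^p)` (well defined in characteristic `p`), as a
`κ`-linear map. [folklore] -/
noncomputable def D (i : Fin n) : Alg κ p n →ₗ[κ] Alg κ p n :=
  (Submodule.Quotient.restrictScalarsEquiv κ (frobIdeal κ p n)).toLinearMap ∘ₗ
    (((frobIdeal κ p n).restrictScalars κ).mapQ ((frobIdeal κ p n).restrictScalars κ)
      (pderiv i).toLinearMap (fun _ hx => pderiv_mem_frobIdeal i hx)) ∘ₗ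
    (Submodule.Quotient.restrictScalarsEquiv κ (frobIdeal κ p n)).symm.toLinearMap

omit hp in
/-- `D i` on representatives. [folklore] -/
private theorem D_mk (i : Fin n) (x : MvPolynomial (Fin n) κ) :
    D κ p n i (Ideal.Quotient.mk _ x) = Ideal.Quotient.mk _ (pderiv i x) := by
  change (Submodule.Quotient.restrictScalarsEquiv κ (frobIdeal κ p n))
      ((((frobIdeal κ p n).restrictScalars κ).mapQ ((frobIdeal κ p n).restrictScalars κ)
        (pderiv i).toLinearMap (fun _ hx => pderiv_mem_frobIdeal i hx))
        ((Submodule.Quotient.restrictScalarsEquiv κ (frobIdeal κ p n)).symm (Submodule.Quotient.mk x))) =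
    Submodule.Quotient.mk (pderiv i x)
  rw [Submodule.Quotient.restrictScalarsEquiv_symm_mk, Submodule.mapQ_apply,
    Submodule.Quotient.restrictScalarsEquiv_mk]
  rfl

omit hp in
/-- Leibniz rule for `D i`. [folklore] -/
private theorem D_mul (i : Fin n) (u v : Alg κ p n) :
    D κ p n i (u * v) = u * D κ p n i v + v * D κ p n i u := by
  obtain ⟨x, rfl⟩ := Ideal.Quotient.mk_surjective u
  obtain ⟨y, rfl⟩ := Ideal.Quotient.mk_surjective v
  rw [← map_mul, D_mk, D_mk, D_mk, pderiv_mul, map_add, map_mul, map_mul]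
  ring

omit hp in
/-- `D i` kills constants. [folklore] -/
private theorem D_algebraMap (i : Fin n) (c : κ) : D κ p n i (algebraMap κ (Alg κ p n) c) = 0 := by
  rw [← Ideal.Quotient.mk_algebraMap, MvPolynomial.algebraMap_eq, D_mk, pderiv_C, map_zero]

omit hp in
/-- The `D i` commute. [folklore] -/
private theorem D_comm (i j : Fin n) : Commute (D κ p n i) (D κ p n j) := by
  apply LinearMap.ext
  intro u
  obtain ⟨x, rfl⟩ := Ideal.Quotient.mk_surjective u
  rw [Module.End.mul_apply, Module.End.mul_apply, D_mk, D_mk, D_mk, D_mk]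
  congr 1
  induction x using MvPolynomial.induction_on' with
  | monomial s a =>
    simp only [pderiv_monomial]
    by_cases hij : i = j
    · subst hij; rfl
    · have h1 : (s - Finsupp.single j 1 - Finsupp.single i 1 : Fin n →₀ ℕ) =
          s - Finsupp.single i 1 - Finsupp.single j 1 := by
        ext l
        rw [Finsupp.tsub_apply, Finsupp.tsub_apply, Finsupp.tsub_apply, Finsupp.tsub_apply,
          Finsupp.single_apply, Finsupp.single_apply]
        split_ifs <;> omega
      have h2 : (s - Finsupp.single j 1 : Fin n →₀ ℕ) i = s i := by
        rw [Finsupp.tsub_apply, Finsupp.single_apply, if_neg (Ne.symm hij), Nat.sub_zero]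
      have h3 : (s - Finsupp.single i 1 : Fin n →₀ ℕ) j = s j := by
        rw [Finsupp.tsub_apply, Finsupp.single_apply, if_neg hij, Nat.sub_zero]
      rw [h1, h2, h3]
      congr 1
      ring
  | add x y hx hy => simp only [map_add, hx, hy]

/-- `(D i)^p = 0`. [folklore] -/
private theorem D_pow_prime_eq_zero (i : Fin n) (u : Alg κ p n) : ((D κ p n i) ^ p) u = 0 := by
  obtain ⟨x, rfl⟩ := Ideal.Quotient.mk_surjective u
  have : ∀ k : ℕ, ((D κ p n i) ^ k) (Ideal.Quotient.mk _ x) = Ideal.Quotient.mk _ ((pderiv i)^[k] x) := by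
    intro k
    induction k with
    | zero => simp
    | succ k ih => rw [pow_succ', Module.End.mul_apply, ih, D_mk, Function.iterate_succ_apply']
  rw [this, iterate_pderiv_prime_eq_zero hp.out, map_zero]

omit hp in
/-- An element of `κ[X]/(Xᵢ^p)` killed by all `∂/∂Xᵢ` is a constant. [folklore] -/
private theorem exists_eq_algebraMap_of_forall_D_eq_zero {u : Alg κ p n} (h : ∀ i, D κ p n i u = 0) :
    ∃ c : κ, u = algebraMap κ (Alg κ p n) c := by
  obtain ⟨x, rfl⟩ := Ideal.Quotient.mk_surjective u
  refine ⟨coeff 0 (trunc p x), ?_⟩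
  rw [← mk_trunc x, ← Ideal.Quotient.mk_algebraMap, MvPolynomial.algebraMap_eq]
  congr 1
  apply eq_C_of_forall_pderiv_eq_zero (truncated_trunc x)
  intro i
  have hi := h i
  rw [← mk_trunc x, D_mk, Ideal.Quotient.eq_zero_iff_mem] at hi
  exact eq_zero_of_truncated_of_mem (truncated_pderiv i (truncated_trunc x)) hi

/-! ### Common zeros of commuting nilpotent operators, and differential simplicity -/

omit [CharP κ p] in
/-- Commuting linear operators `E₁, …, Eₙ` with `Eᵢ^p = 0` have a common zero in any nonzero
subset stable under all of them. [folklore] -/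
private theorem exists_common_zero {M : Type*} [AddCommGroup M] [Module κ M] (E : Fin n → M →ₗ[κ] M)
    (hcomm : ∀ i j, Commute (E i) (E j)) (hnil : ∀ i x, ((E i) ^ p) x = 0) (S : Set M)
    (hS : ∀ i, ∀ x ∈ S, E i x ∈ S) {v : M} (hv : v ∈ S) (hv0 : v ≠ 0) :
    ∃ w ∈ S, w ≠ 0 ∧ ∀ i, E i w = 0 := by
  suffices H : ∀ m : ℕ, m ≤ n → ∃ w ∈ S, w ≠ 0 ∧ ∀ i : Fin n, (i : ℕ) < m → E i w = 0 by
    obtain ⟨w, hwS, hw0, hw⟩ := H n le_rfl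
    exact ⟨w, hwS, hw0, fun i => hw i i.2⟩
  intro m
  induction m with
  | zero => exact fun _ => ⟨v, hv, hv0, fun i hi => absurd hi (Nat.not_lt_zero _)⟩
  | succ m ih =>
    intro hm
    obtain ⟨w, hwS, hw0, hw⟩ := ih (Nat.le_of_succ_le hm)
    set i₀ : Fin n := ⟨m, hm⟩
    have hpowS : ∀ k : ℕ, ((E i₀) ^ k) w ∈ S := by
      intro k
      induction k with
      | zero => simpa using hwS
      | succ k ihk => rw [pow_succ', Module.End.mul_apply]; exact hS i₀ _ ihk
    have hex : ∃ k : ℕ, ((E i₀) ^ (k + 1)) w = 0 := ⟨p - 1, by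
      rw [Nat.sub_add_cancel hp.out.pos]; exact hnil i₀ w⟩
    classical
    let k₀ := Nat.find hex
    have hk₀ : ((E i₀) ^ (k₀ + 1)) w = 0 := Nat.find_spec hex
    refine ⟨((E i₀) ^ k₀) w, hpowS k₀, ?_, ?_⟩
    · intro hzero
      rcases Nat.eq_zero_or_eq_succ_pred k₀ with h0 | hs
      · rw [h0, pow_zero, Module.End.one_apply] at hzero
        exact hw0 hzero
      · have hmin := Nat.find_min hex (show k₀ - 1 < k₀ by omega)
        rw [show k₀ - 1 + 1 = k₀ by omega] at hmin
        exact hmin hzero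
    · intro i hi
      rcases Nat.lt_succ_iff_lt_or_eq.mp hi with hlt | heq
      · have hc : E i * (E i₀) ^ k₀ = (E i₀) ^ k₀ * E i := (hcomm i i₀).pow_right k₀
        rw [← Module.End.mul_apply, hc, Module.End.mul_apply, hw i hlt, map_zero]
      · have : i = i₀ := Fin.ext heq
        subst this
        rw [← Module.End.mul_apply, ← pow_succ', hk₀]

/-- **Differential simplicity of `κ[X₁,…,Xₙ]/(Xᵢ^p)`** (`char κ = p`): a nonzero ideal stable under all
the partial derivatives `∂/∂Xᵢ` is the unit ideal — the statement «no nontrivial ideal in `R̃` is stable under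
`D̃`» of KN 1982 p. 376 l. 3–4 for the truncated polynomial ring `R̃ = R/𝔪^{(p)}R` (there deduced from S. Yuan's
`Hom_{R^p}(R,R) = R[D]`; here proved directly: commuting nilpotent operators have a common zero in a stable
ideal, and a common zero of all `∂/∂Xᵢ` is a constant). [cite: KimuraNiitsuma1982, §3 p. 376 l. 3–4] -/
theorem ideal_eq_top_of_forall_D_mem (J : Ideal (Alg κ p n)) (hJ : J ≠ ⊥)
    (hstab : ∀ i, ∀ u ∈ J, D κ p n i u ∈ J) : J = ⊤ := by
  obtain ⟨v, hvJ, hv0⟩ := J.ne_bot_iff.mp hJ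
  obtain ⟨w, hwJ, hw0, hw⟩ := exists_common_zero (D κ p n) D_comm D_pow_prime_eq_zero (J : Set _)
    hstab hvJ hv0
  obtain ⟨c, rfl⟩ := exists_eq_algebraMap_of_forall_D_eq_zero hw
  have hc : c ≠ 0 := fun h => hw0 (by rw [h, map_zero])
  exact Ideal.eq_top_of_isUnit_mem J hwJ ((IsUnit.mk0 c hc).map _)

/-! ### The monomial basis of `κ[X]/(Xᵢ^p)` and its dimension `p^n` -/

/-- Exponent vector of a reduced monomial indexed by `f : Fin n → Fin p`. [folklore] -/
noncomputable def expnt (f : Fin n → Fin p) : Fin n →₀ ℕ :=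
  Finsupp.equivFunOnFinite.symm fun i => (f i : ℕ)

omit hp [CharP κ p] in
/-- Components of `expnt`. [folklore] -/
@[simp] private theorem expnt_apply (f : Fin n → Fin p) (i : Fin n) : expnt f i = (f i : ℕ) := by
  simp [expnt]

omit hp [CharP κ p] in
/-- `expnt` is injective. [folklore] -/
private theorem expnt_injective : Function.Injective (expnt (n := n) (p := p)) := by
  intro f g h
  funext i
  exact Fin.ext (by rw [← expnt_apply f i, ← expnt_apply g i, h])

variable (κ p n) in
/-- The reduced monomials `X^m`, `0 ≤ mᵢ < p`, in `κ[X]/(Xᵢ^p)`. [folklore] -/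
noncomputable def monBasisFun (f : Fin n → Fin p) : Alg κ p n :=
  Ideal.Quotient.mkₐ κ (frobIdeal κ p n) (monomial (expnt f) (1 : κ))

omit hp [CharP κ p] in
/-- Reduced monomials are linearly independent in `κ[X]/(Xᵢ^p)`. [folklore] -/
private theorem linearIndependent_monBasisFun : LinearIndependent κ (monBasisFun κ p n) := by
  classical
  rw [linearIndependent_iff']
  intro s g hg f hf
  have hsum : ∑ f ∈ s, g f • monBasisFun κ p n f =
      Ideal.Quotient.mkₐ κ (frobIdeal κ p n) (∑ f ∈ s, monomial (expnt f) (g f)) := by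
    rw [map_sum]
    refine Finset.sum_congr rfl fun f _ => ?_
    rw [monBasisFun, ← map_smul, smul_monomial, smul_eq_mul, mul_one]
  rw [hsum, Ideal.Quotient.mkₐ_eq_mk, Ideal.Quotient.eq_zero_iff_mem] at hg
  have htr : ∀ m ∈ (∑ f ∈ s, monomial (expnt f) (g f)).support, ∀ i, m i < p := by
    intro m hm i
    have hm' := support_sum hm
    rw [Finset.mem_biUnion] at hm'
    obtain ⟨f', _, hf'⟩ := hm'
    rw [support_monomial] at hf'
    split_ifs at hf' with h0
    · simp at hf'
    · rw [Finset.mem_singleton] at hf'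
      rw [hf', expnt_apply]
      exact (f' i).2
  have hzero := eq_zero_of_truncated_of_mem htr hg
  have hcoeff := congrArg (coeff (expnt f)) hzero
  rw [coeff_sum, coeff_zero] at hcoeff
  simp_rw [coeff_monomial] at hcoeff
  rw [Finset.sum_eq_single f (fun f' _ hne => if_neg fun h => hne (expnt_injective h))
    (fun h => absurd hf h), if_pos rfl] at hcoeff
  exact hcoeff

omit hp [CharP κ p] in
/-- Reduced monomials span `κ[X]/(Xᵢ^p)`. [folklore] -/
private theorem span_monBasisFun : ⊤ ≤ Submodule.span κ (Set.range (monBasisFun κ p n)) := by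
  classical
  intro u _
  obtain ⟨x, rfl⟩ := Ideal.Quotient.mk_surjective u
  rw [← mk_trunc x, trunc, map_sum]
  refine Submodule.sum_mem _ fun m hm => ?_
  rw [Finset.mem_filter] at hm
  have hmono : monomial m (coeff m x) = coeff m x • monomial m (1 : κ) := by
    rw [smul_monomial, smul_eq_mul, mul_one]
  let f : Fin n → Fin p := fun i => ⟨m i, hm.2 i⟩
  have hmf : expnt f = m := by
    ext i; rw [expnt_apply]
  rw [hmono, ← Ideal.Quotient.mkₐ_eq_mk κ, map_smul]
  refine Submodule.smul_mem _ _ (Submodule.subset_span ⟨f, ?_⟩)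
  rw [monBasisFun, hmf]

variable (κ p n) in
/-- The monomial basis of `κ[X]/(Xᵢ^p)`. [folklore] -/
noncomputable def monBasis : Module.Basis (Fin n → Fin p) κ (Alg κ p n) :=
  Module.Basis.mk linearIndependent_monBasisFun span_monBasisFun

omit hp [CharP κ p] in
/-- `dim_κ κ[X₁,…,Xₙ]/(Xᵢ^p) = p^n`. [folklore] -/
private theorem finrank_alg : Module.finrank κ (Alg κ p n) = p ^ n := by
  rw [Module.finrank_eq_card_basis (monBasis κ p n), Fintype.card_fun, Fintype.card_fin,
    Fintype.card_fin]

omit hp [CharP κ p] in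
/-- `κ[X]/(Xᵢ^p)` is finite-dimensional. [folklore] -/
private theorem finite_alg : Module.Finite κ (Alg κ p n) := Module.Finite.of_basis (monBasis κ p n)

end TruncPoly

/-! ## The dimension-two case of the Lemma-5 input, and the theorem for `dim R ≤ 2` -/

namespace RelativePBasis

open IsLocalRing Module Literature.AlgebraicGeometry.Resolution

universe u

variable {p : ℕ} [hp : Fact p.Prime]

/-- `R/I` has characteristic `p` for a proper ideal `I` (copy of the file-private helper). [folklore] -/
private theorem charP_quotient_of_ne_top' {R : Type u} [CommRing R] [CharP R p] (I : Ideal R)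
    (hI : I ≠ ⊤) : CharP (R ⧸ I) p :=
  CharP.quotient' p I fun x hx => by
    by_contra h
    have hndvd : ¬ p ∣ x := fun hd => h ((CharP.cast_eq_zero_iff R p x).mpr hd)
    exact hI (I.eq_top_of_isUnit_mem hx ((CharP.isUnit_natCast_iff hp.out).mpr hndvd))

omit hp in
/-- A ring is adically complete for a nilpotent ideal. [folklore] -/
private theorem isAdicComplete_of_pow_eq_bot {R : Type*} [CommRing R] {I : Ideal R} {N : ℕ}
    (hN : I ^ N = ⊥) : IsAdicComplete I R where
  haus' := by
    intro x hx
    have h := hx N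
    rw [SModEq.zero, smul_eq_mul, Ideal.mul_top, hN] at h
    simpa using h
  prec' := by
    intro f hf
    refine ⟨f N, fun k => ?_⟩
    rcases le_total k N with h | h
    · exact hf h
    · have h2 : f N ≡ f k [SMOD (I ^ N • ⊤ : Submodule R R)] := hf h
      rw [SModEq.sub_mem, smul_eq_mul, Ideal.mul_top, hN, Ideal.mem_bot, sub_eq_zero] at h2
      rw [h2]

omit hp in
/-- Coordinates, in an `R'`-basis of `R`, of an element of `𝔮R` lie in `𝔮`. [folklore] -/
private theorem repr_mem_of_mem_map {R : Type u} [CommRing R] {R' : Subring R} {ι : Type*} [Fintype ι]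
    (b : Module.Basis ι R' R) (𝔮 : Ideal R') {v : R} (hv : v ∈ 𝔮.map (algebraMap R' R)) (i : ι) :
    b.repr v i ∈ 𝔮 := by
  classical
  induction hv using Submodule.span_induction generalizing i with
  | mem v hv =>
    obtain ⟨q, hq, rfl⟩ := hv
    have : (algebraMap R' R q) = q • (1 : R) := by rw [Algebra.smul_def, mul_one]
    rw [this, map_smul, Finsupp.smul_apply, smul_eq_mul]
    exact Ideal.mul_mem_right _ _ hq
  | zero => simp
  | add v w _ _ hv hw => rw [map_add, Finsupp.add_apply]; exact add_mem (hv i) (hw i)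
  | smul r v _ ih =>
    have hv_eq : v = ∑ j, (b.repr v j) • b j := (b.sum_repr v).symm
    have : r • v = ∑ j, (b.repr v j) • (r * b j) := by
      conv_lhs => rw [hv_eq]
      rw [smul_eq_mul, Finset.mul_sum]
      refine Finset.sum_congr rfl fun j _ => ?_
      simp only [Subring.smul_def, smul_eq_mul]
      ring
    rw [this, map_sum, Finset.sum_apply']
    refine Ideal.sum_mem _ fun j _ => ?_
    rw [map_smul, Finsupp.smul_apply, smul_eq_mul]
    exact Ideal.mul_mem_right _ _ (ih j)

variable {R : Type u} [CommRing R] [CharP R p] {R' : Subring R}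

/-- `ℕ`-casts `0 < m < p` are units in characteristic `p`. [folklore] -/
private theorem isUnit_natCast_of_lt {A : Type*} [CommRing A] [CharP A p] {m : ℕ} (h0 : 0 < m) (hm : m < p) :
    IsUnit (m : A) :=
  (CharP.isUnit_natCast_iff hp.out).mpr fun hd => absurd (Nat.le_of_dvd h0 hd) (not_le.mpr hm)

/-- **Trivial case of Harper's theorem (the differential step).** Let `A ⊆ P` be a local subring of
characteristic `p` over which `P` is free, and let `E₁, …, E_m` be additive maps of `P` satisfying the Leibniz
rule such that no nonzero proper ideal of `P` is stable under all of them. If `𝔫_A P` is a nonzero proper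
ideal, then some `a ∈ 𝔫_A` has `a^{p-1} ≠ 0` (a component of some `Eᵢ` is a "derivation" `∂` of `A` with
`∂ a` a unit, and `∂(a^{j+1}) = (j+1) a^j ∂a`). [cite: KimuraNiitsuma1982, §3 p. 375–376 (Yuan's argument)] -/
theorem exists_pow_ne_zero_of_dsimple {P : Type*} [CommRing P] (A : Subring P) [IsLocalRing A]
    [CharP A p] {ι : Type*} [Fintype ι] (bP : Module.Basis ι A P) {m : ℕ} (E : Fin m → P → P)
    (hadd : ∀ i u v, E i (u + v) = E i u + E i v)
    (hE : ∀ i u v, E i (u * v) = u * E i v + v * E i u)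
    (hsimple : ∀ J : Ideal P, J ≠ ⊥ → (∀ i, ∀ u ∈ J, E i u ∈ J) → J = ⊤)
    (hJ : (maximalIdeal A).map A.subtype ≠ ⊤) (hJ0 : (maximalIdeal A).map A.subtype ≠ ⊥) :
    ∃ a ∈ maximalIdeal A, a ^ (p - 1) ≠ 0 := by
  classical
  set J := (maximalIdeal A).map A.subtype with hJdef
  have hE0 : ∀ i, E i 0 = 0 := fun i => by
    have := hE i 0 0
    simpa using this
  -- some generator `a ∈ 𝔫_A` is moved out of `J`
  have hgen : ∃ i, ∃ a ∈ maximalIdeal A, E i (a : P) ∉ J := by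
    by_contra hall
    push Not at hall
    apply hJ
    apply hsimple J hJ0
    intro i u hu
    induction hu using Submodule.span_induction with
    | mem u hu =>
      obtain ⟨a, ha, rfl⟩ := hu
      exact hall i a ha
    | zero => rw [hE0]; exact zero_mem _
    | add u v _ _ hu hv => rw [hadd]; exact add_mem hu hv
    | smul r u hu ih =>
      rw [smul_eq_mul, hE i]
      exact add_mem (Ideal.mul_mem_left _ _ ih) (Ideal.mul_mem_right _ _ hu)
  obtain ⟨i, a, ha, hEa⟩ := hgen
  -- some coordinate of `E i a` is a unit of `A`
  have hcoord : ∃ j, bP.repr (E i (a : P)) j ∉ maximalIdeal A := by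
    by_contra hall
    push Not at hall
    apply hEa
    rw [← bP.sum_repr (E i (a : P))]
    refine Ideal.sum_mem _ fun j _ => ?_
    rw [Subring.smul_def]
    exact Ideal.mul_mem_right _ _ (Ideal.mem_map_of_mem _ (hall j))
  obtain ⟨j, hj⟩ := hcoord
  have hunit : IsUnit (bP.repr (E i (a : P)) j) := by
    by_contra h
    exact hj ((IsLocalRing.mem_maximalIdeal _).mpr h)
  -- the component "derivation" `∂ b = (E i b)_j`
  let δ : A → A := fun b => bP.repr (E i (b : P)) j
  have hδ_mul : ∀ b c : A, δ (b * c) = b * δ c + c * δ b := by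
    intro b c
    change bP.repr (E i ((b * c : A) : P)) j = _
    rw [Subring.coe_mul, hE i, show (b : P) * E i (c : P) = b • E i (c : P) from rfl,
      show (c : P) * E i (b : P) = c • E i (b : P) from rfl, map_add, map_smul, map_smul,
      Finsupp.add_apply, Finsupp.smul_apply, Finsupp.smul_apply, smul_eq_mul, smul_eq_mul]
  have hδ_pow : ∀ k : ℕ, δ (a ^ (k + 1)) = (k + 1 : ℕ) * a ^ k * δ a := by
    intro k
    induction k with
    | zero => simp
    | succ k ih =>
      rw [pow_succ, hδ_mul, ih]
      push_cast
      ring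
  have hδ0 : δ 0 = 0 := by
    change bP.repr (E i ((0 : A) : P)) j = 0
    rw [Subring.coe_zero, hE0, map_zero, Finsupp.zero_apply]
  -- `a^k ≠ 0` for `k ≤ p - 1`
  have hpow : ∀ k : ℕ, k ≤ p - 1 → a ^ k ≠ 0 := by
    intro k
    induction k with
    | zero => intro _; rw [pow_zero]; exact one_ne_zero
    | succ k ih =>
      intro hk hzero
      have h1 := hδ_pow k
      rw [hzero, hδ0] at h1
      have hk1 : IsUnit ((k + 1 : ℕ) : A) := isUnit_natCast_of_lt (Nat.succ_pos k) (by omega)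
      have : a ^ k = 0 := by
        have h2 : ((k + 1 : ℕ) : A) * δ a * a ^ k = 0 := by rw [h1]; ring
        exact (IsUnit.mul_right_eq_zero (hk1.mul hunit)).mp h2
      exact ih (by omega) this
  exact ⟨a, ha, hpow (p - 1) le_rfl⟩


omit hp in
/-- If `a^p = 0 ≠ a^{p-1}` in an algebra over a field, then `1, a, …, a^{p-1}` are linearly independent.
[folklore] -/
private theorem linearIndependent_pow_of_pow_eq_zero {A : Type*} [CommRing A] {κ : Type*} [Field κ] [Algebra κ A]
    {a : A} (hap0 : a ^ p = 0) (hap : a ^ (p - 1) ≠ 0) :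
    LinearIndependent κ (fun j : Fin p => a ^ (j : ℕ)) := by
  rw [Fintype.linearIndependent_iff]
  intro g hg
  have key : ∀ k : ℕ, ∀ hk : k < p, g ⟨k, hk⟩ = 0 := by
    intro k
    induction k using Nat.strong_induction_on with
    | _ k ih =>
      intro hk
      have h := congrArg (· * a ^ (p - 1 - k)) hg
      simp only [Finset.sum_mul, zero_mul] at h
      rw [Finset.sum_eq_single ⟨k, hk⟩] at h
      · have hk' : k + (p - 1 - k) = p - 1 := by omega
        rw [smul_mul_assoc, ← pow_add, hk'] at h
        by_contra hgk
        apply hap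
        have := congrArg ((g ⟨k, hk⟩)⁻¹ • ·) h
        simpa only [smul_zero, smul_smul, inv_mul_cancel₀ hgk, one_smul] using this
      · intro j _ hjk
        have hjk' : (j : ℕ) ≠ k := fun h => hjk (Fin.ext h)
        rcases lt_or_gt_of_ne hjk' with hlt | hgt
        · have hj0 : g j = 0 := ih j hlt j.2
          rw [hj0, zero_smul, zero_mul]
        · have hexp : (j : ℕ) + (p - 1 - k) = p + ((j : ℕ) + (p - 1 - k) - p) := by omega
          rw [smul_mul_assoc, ← pow_add, hexp, pow_add, hap0, zero_mul, smul_zero]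
      · intro h; exact absurd (Finset.mem_univ _) h
  intro j
  exact key j j.2

/-- In a local algebra `A` over a field `κ`, if the powers `1, a, …, a^{p-1}` of some `a ∈ 𝔫_A` span `A`,
then `𝔫_A = aA`. [folklore] -/
private theorem mem_span_singleton_of_span_pow_eq_top {A : Type*} [CommRing A] [IsLocalRing A] {κ : Type*}
    [Field κ] [Algebra κ A] {a : A} (ha : a ∈ maximalIdeal A)
    (hspan : Submodule.span κ (Set.range fun j : Fin p => a ^ (j : ℕ)) = ⊤) {b : A}
    (hb : b ∈ maximalIdeal A) : b ∈ Ideal.span {a} := by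
  have hp' : p.Prime := hp.out
  have hbspan : b ∈ Submodule.span κ (Set.range fun j : Fin p => a ^ (j : ℕ)) := by
    rw [hspan]; exact Submodule.mem_top
  rw [Submodule.mem_span_range_iff_exists_fun] at hbspan
  obtain ⟨g, rfl⟩ := hbspan
  have hg0 : g ⟨0, hp'.pos⟩ = 0 := by
    have hres0 : residue A (∑ j, g j • a ^ ((j : Fin p) : ℕ)) = 0 :=
      (IsLocalRing.residue_eq_zero_iff _).mpr hb
    rw [map_sum, Finset.sum_eq_single ⟨0, hp'.pos⟩] at hres0
    · rw [pow_zero, Algebra.smul_def, mul_one, IsLocalRing.residue_eq_zero_iff] at hres0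
      by_contra hg
      exact (IsLocalRing.mem_maximalIdeal _).mp hres0 ((IsUnit.mk0 _ hg).map _)
    · intro j _ hj0
      have hjpos : (j : ℕ) ≠ 0 := fun h => hj0 (Fin.ext h)
      rw [Algebra.smul_def, map_mul, map_pow, (IsLocalRing.residue_eq_zero_iff _).mpr ha,
        zero_pow hjpos, mul_zero]
    · intro h; exact absurd (Finset.mem_univ _) h
  refine Ideal.sum_mem _ fun j _ => ?_
  by_cases hj : (j : ℕ) = 0
  · have : j = ⟨0, hp'.pos⟩ := Fin.ext hj
    rw [this, hg0, zero_smul]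
    exact zero_mem _
  · rw [Algebra.smul_def, ← Nat.succ_pred_eq_of_ne_zero hj, pow_succ, ← mul_assoc]
    exact Ideal.mul_mem_left _ _ (Ideal.mem_span_singleton_self a)

/-- For `R ⊇ R' ⊇ R^p` with `R` free of rank one over `R'`, `R' = R`. [folklore] -/
private theorem eq_top_of_finrank_eq_one [Nontrivial R] (hR' : (frobenius R p).range ≤ R') [Module.Free R' R]
    [Module.Finite R' R] (h : Module.finrank R' R = 1) : R' = ⊤ := by
  classical
  let b := Module.Free.chooseBasis R' R
  have hcard : Fintype.card (Module.Free.ChooseBasisIndex R' R) = 1 := by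
    rw [← Module.finrank_eq_card_chooseBasisIndex, h]
  obtain ⟨i₀, hi₀⟩ := Fintype.card_eq_one_iff.mp hcard
  have hrepr : ∀ w : R, w = (b.repr w i₀ : R) * b i₀ := by
    intro w
    conv_lhs => rw [← b.sum_repr w]
    rw [Fintype.sum_eq_single i₀ (fun j hj => absurd (hi₀ j) hj), Subring.smul_def, smul_eq_mul]
  set c : R' := b.repr 1 i₀ with hc
  have h1 : (c : R) * b i₀ = 1 := (hrepr 1).symm
  have hcR : IsUnit (c : R) := IsUnit.of_mul_eq_one _ h1
  obtain ⟨u, hu⟩ := isUnit_of_isUnit_coe hR' hcR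
  have hcu : (c : R) * ((↑u⁻¹ : R') : R) = 1 := by
    rw [← hu, ← Subring.coe_mul, Units.mul_inv, Subring.coe_one]
  have he : b i₀ = ((↑u⁻¹ : R') : R) := hcR.mul_left_cancel (h1.trans hcu.symm)
  rw [eq_top_iff]
  intro w _
  rw [hrepr w, he]
  exact R'.mul_mem (b.repr w i₀).2 (↑u⁻¹ : R').2


/-- **The component derivations** (KN 1982 p. 375 l. −2 – p. 376 l. 6: «`∂x = (∂₁x)b₁ + ⋯ + (∂ₙx)bₙ` with
`∂ᵢx ∈ R̃'` … `x ↦ ∂ᵢx` is a derivation on `R̃'` … `∂ᵢ I` cannot be contained in `I` … Thus `R̃'` is a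
differentiably simple ring»). Let `A ⊆ P` be a subring over which `P` is free, `κ → A → P` algebras, and `Eᵢ`
additive Leibniz maps of `P` killing `κ` under which no nonzero proper ideal of `P` is stable. Then every nonzero
proper ideal `I` of `A` is moved by some `κ`-derivation of `A` (a coordinate of some `Eᵢ` in the `A`-basis).
[cite: KimuraNiitsuma1982, §3 p. 375 l. −2 – p. 376 l. 6] -/
theorem exists_derivation_of_dsimple {P : Type*} [CommRing P] (A : Subring P) {κ : Type*} [Field κ]
    [Algebra κ A] [Algebra κ P] [IsScalarTower κ A P] {ι : Type*} [Fintype ι] (bP : Module.Basis ι A P)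
    {m : ℕ} (E : Fin m → P → P) (hadd : ∀ i u v, E i (u + v) = E i u + E i v)
    (hE : ∀ i u v, E i (u * v) = u * E i v + v * E i u) (hEκ : ∀ i (c : κ), E i (algebraMap κ P c) = 0)
    (hsimple : ∀ J : Ideal P, J ≠ ⊥ → (∀ i, ∀ u ∈ J, E i u ∈ J) → J = ⊤) (I : Ideal A) (hI0 : I ≠ ⊥)
    (hI1 : I ≠ ⊤) :
    ∃ δ : A → A, (∀ b c, δ (b + c) = δ b + δ c) ∧ (∀ b c, δ (b * c) = b * δ c + c * δ b) ∧
      (∀ c : κ, δ (algebraMap κ A c) = 0) ∧ ∃ b ∈ I, δ b ∉ I := by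
  classical
  haveI : Module.Free A P := Module.Free.of_basis bP
  have hE0 : ∀ i, E i 0 = 0 := fun i => by
    have := hE i 0 0
    simpa using this
  set J := I.map A.subtype with hJdef
  obtain ⟨b0, hb0I, hb0⟩ := I.ne_bot_iff.mp hI0
  haveI : Nontrivial A := ⟨⟨b0, 0, hb0⟩⟩
  haveI : Nontrivial P := ⟨⟨(b0 : P), 0, fun h => hb0 (Subtype.ext h)⟩⟩
  have hJ0 : J ≠ ⊥ := by
    intro h
    apply hb0
    have : (b0 : P) ∈ J := Ideal.mem_map_of_mem _ hb0I
    rw [h, Ideal.mem_bot] at this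
    exact Subtype.ext this
  have hJ1 : J ≠ ⊤ := by
    intro h
    apply hI1
    have := Ideal.comap_map_eq_self_of_faithfullyFlat (B := P) I
    change J.comap (algebraMap A P) = I at this
    rw [← this, h, Ideal.comap_top]
  -- some generator `b ∈ I` is moved out of `J`
  have hgen : ∃ i, ∃ b ∈ I, E i (b : P) ∉ J := by
    by_contra hall
    push Not at hall
    apply hJ1
    apply hsimple J hJ0
    intro i u hu
    induction hu using Submodule.span_induction with
    | mem u hu =>
      obtain ⟨a, ha, rfl⟩ := hu
      exact hall i a ha
    | zero => rw [hE0]; exact zero_mem _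
    | add u v _ _ hu hv => rw [hadd]; exact add_mem hu hv
    | smul r u hu ih =>
      rw [smul_eq_mul, hE i]
      exact add_mem (Ideal.mul_mem_left _ _ ih) (Ideal.mul_mem_right _ _ hu)
  obtain ⟨i, b, hb, hEb⟩ := hgen
  have hcoord : ∃ j, bP.repr (E i (b : P)) j ∉ I := by
    by_contra hall
    push Not at hall
    apply hEb
    rw [← bP.sum_repr (E i (b : P))]
    refine Ideal.sum_mem _ fun j _ => ?_
    rw [Subring.smul_def]
    exact Ideal.mul_mem_right _ _ (Ideal.mem_map_of_mem _ (hall j))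
  obtain ⟨j, hj⟩ := hcoord
  refine ⟨fun c => bP.repr (E i (c : P)) j, ?_, ?_, ?_, b, hb, hj⟩
  · intro c d
    show bP.repr (E i ((c + d : A) : P)) j = bP.repr (E i (c : P)) j + bP.repr (E i (d : P)) j
    rw [Subring.coe_add, hadd, map_add, Finsupp.add_apply]
  · intro c d
    show bP.repr (E i ((c * d : A) : P)) j = c * bP.repr (E i (d : P)) j + d * bP.repr (E i (c : P)) j
    rw [Subring.coe_mul, hE i, show (c : P) * E i (d : P) = c • E i (d : P) from rfl,
      show (d : P) * E i (c : P) = d • E i (c : P) from rfl, map_add, map_smul, map_smul,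
      Finsupp.add_apply, Finsupp.smul_apply, Finsupp.smul_apply, smul_eq_mul, smul_eq_mul]
  · intro c
    show bP.repr (E i (algebraMap A P (algebraMap κ A c))) j = 0
    rw [← IsScalarTower.algebraMap_apply κ A P, hEκ, map_zero, Finsupp.zero_apply]

set_option maxHeartbeats 1600000 in
/-- **KN 1982 Lemma 5, content used on p. 377, CASE `dim R = 2` (proved here; any rank; no completion,
no Harper).** For a pair `R ⊋ R' ⊇ R^p` of regular local rings with `R` module-finite over `R'` and the same
residue field, if `dim R = 2` then some `z ∈ 𝔪` has `z^p ∉ 𝔪'²`. Route (ours, assembling the printed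
ingredients in the Artinian fibre instead of the completion): with `𝔪 = (x₁, x₂)`, `𝔮 = (x₁^p, x₂^p)R'`,
`P = R/𝔮R ⊇ A = R'/𝔮` (`𝔮R ∩ R' = 𝔮` by faithful flatness), `P` is `A`-free of rank `rank_{R'} R`,
`ℓ(P) = p²` (Kunz: flat Frobenius, Lech's independence count, tree `Kunz1969.length_quotient_frobeniusPower_eq`),
a coefficient field `κ ⊆ A` (Cohen, tree) makes `P ≅ κ[X₁,X₂]/(X₁^p,X₂^p)` (dimension count), whose partial
derivatives leave no nonzero proper ideal stable (`TruncPoly.ideal_eq_top_of_forall_D_mem`); a component of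
one of them is a derivation of `A` moving `𝔫_A`, whence some `a ∈ 𝔫_A` has `a^{p-1} ≠ 0`
(`exists_pow_ne_zero_of_dsimple`), so `dim_κ A ≥ p`, and `dim_κ A · rank = p²` forces `A = κ[a]`,
`𝔫_A = aA`, `𝔪' = yR' + 𝔮`; as `𝔪'` needs two generators, some `xᵢ^p ∉ 𝔪'²`.
[cite: KimuraNiitsuma1982, Lemma 5 p. 376; §3 p. 375–376] -/
theorem lemma5_of_ringKrullDim_eq_two [IsRegularLocalRing R] (hR' : (frobenius R p).range ≤ R')
    (hreg : IsRegularLocalRing R') [Module.Finite R' R] (hdim : ringKrullDim R = 2) (hne : R' ≠ ⊤)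
    (hres : ∀ x : R, ∃ x' ∈ R', x - x' ∈ maximalIdeal R) :
    ∃ z ∈ maximalIdeal R, (⟨z ^ p, hR' ⟨z, rfl⟩⟩ : R') ∉ maximalIdeal R' ^ 2 := by
  classical
  haveI := hreg
  have hp' : p.Prime := hp.out
  haveI : IsDomain R := isDomain_of_isRegularLocalRing R
  haveI := isLocalHom_algebraMap hR'
  haveI : Module.Free R' R := free hR' hreg
  haveI : Nontrivial R' := R'.subtype.domain_nontrivial
  -- a regular system of parameters
  have hr2' : (maximalIdeal R).spanFinrank = 2 := by
    have e := IsRegularLocalRing.spanFinrank_maximalIdeal (R := R)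
    rw [hdim] at e
    exact_mod_cast e
  obtain ⟨n, x, hx, hn⟩ : ∃ (n : ℕ) (x : Fin n → R), Ideal.span (Set.range x) = maximalIdeal R ∧
      (maximalIdeal R).spanFinrank = n :=
    ⟨_, (Kunz1969.exists_span_range_eq (maximalIdeal R)).choose,
      (Kunz1969.exists_span_range_eq (maximalIdeal R)).choose_spec, rfl⟩
  have hr2 : n = 2 := hn.symm.trans hr2'
  have hxm : ∀ i, x i ∈ maximalIdeal R := fun i => by
    rw [← hx]; exact Ideal.subset_span ⟨i, rfl⟩
  -- the ideals `𝔮 = (xᵢ^p) R'` and `𝔮R`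
  set xp' : Fin n → R' := fun i => ⟨x i ^ p, hR' ⟨x i, rfl⟩⟩ with hxp'
  set 𝔮 : Ideal R' := Ideal.span (Set.range xp') with h𝔮
  set Iq : Ideal R := Ideal.span (Set.range fun i => x i ^ p ^ 1) with hIq_def
  have hfun : (fun i => x i ^ p ^ 1) = (algebraMap R' R) ∘ xp' := by
    funext i
    rw [pow_one]
    rfl
  have hIq_map : Iq = 𝔮.map (algebraMap R' R) := by
    rw [hIq_def, h𝔮, Ideal.map_span, ← Set.range_comp, hfun]
  have hlen : Module.length R (R ⧸ Iq) = (p ^ 2 : ℕ) := by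
    have := Kunz1969.length_quotient_frobeniusPower_eq (flat_frobenius_of_isRegularLocalRing p R) x hx
      hn 1
    rw [this, hr2, pow_one]
  have hIq_le : Iq ≤ maximalIdeal R := by
    rw [hIq_def, Ideal.span_le]
    rintro _ ⟨i, rfl⟩
    exact Ideal.pow_mem_of_mem _ (hxm i) _ (pow_pos hp'.pos 1)
  have hIq_ne : Iq ≠ ⊤ := fun h => (maximalIdeal.isMaximal R).ne_top (top_le_iff.mp (h ▸ hIq_le))
  haveI : Nontrivial (R ⧸ Iq) := Ideal.Quotient.nontrivial_iff.mpr hIq_ne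
  haveI : IsLocalRing (R ⧸ Iq) :=
    IsLocalRing.of_surjective' (Ideal.Quotient.mk Iq) Ideal.Quotient.mk_surjective
  haveI hcharP : CharP (R ⧸ Iq) p := charP_quotient_of_ne_top' Iq hIq_ne
  -- maximal ideal of `P = R/𝔮R`
  have hmP : ∀ y : R, Ideal.Quotient.mk Iq y ∈ maximalIdeal (R ⧸ Iq) ↔ y ∈ maximalIdeal R := by
    intro y
    rw [IsLocalRing.mem_maximalIdeal, IsLocalRing.mem_maximalIdeal, mem_nonunits_iff,
      mem_nonunits_iff, not_iff_not]
    constructor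
    · intro hu
      obtain ⟨v, hv⟩ := hu.exists_left_inv
      obtain ⟨w, rfl⟩ := Ideal.Quotient.mk_surjective v
      rw [← map_mul, ← (Ideal.Quotient.mk Iq).map_one, Ideal.Quotient.mk_eq_mk_iff_sub_mem] at hv
      by_contra hy
      have h1 : w * y - 1 ∈ maximalIdeal R := hIq_le hv
      have h2 : w * y ∈ maximalIdeal R := Ideal.mul_mem_left _ _ ((IsLocalRing.mem_maximalIdeal _).mpr hy)
      have : (1 : R) ∈ maximalIdeal R := by
        have := sub_mem h2 h1
        rwa [sub_sub_cancel] at this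
      exact (maximalIdeal.isMaximal R).ne_top (Ideal.eq_top_of_isUnit_mem _ this isUnit_one)
    · exact fun hu => hu.map _
  have hmP_eq : maximalIdeal (R ⧸ Iq) = Ideal.span (Set.range fun i => Ideal.Quotient.mk Iq (x i)) := by
    apply le_antisymm
    · intro u hu
      obtain ⟨y, rfl⟩ := Ideal.Quotient.mk_surjective u
      have hy : y ∈ Ideal.span (Set.range x) := by rw [hx]; exact (hmP y).mp hu
      have hspan : Ideal.span (Set.range fun i => Ideal.Quotient.mk Iq (x i)) =
          (Ideal.span (Set.range x)).map (Ideal.Quotient.mk Iq) := by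
        rw [Ideal.map_span, ← Set.range_comp]
        rfl
      rw [hspan]
      exact Ideal.mem_map_of_mem _ hy
    · rw [Ideal.span_le]
      rintro _ ⟨i, rfl⟩
      exact (hmP _).mpr (hxm i)
  have hmap' : (Ideal.span (Set.range x)).map (Ideal.Quotient.mk Iq) =
      Ideal.span (Set.range fun i => Ideal.Quotient.mk Iq (x i)) := by
    rw [Ideal.map_span, ← Set.range_comp]
    rfl
  have hmP_map : maximalIdeal (R ⧸ Iq) = (maximalIdeal R).map (Ideal.Quotient.mk Iq) := by
    rw [hmP_eq, ← hmap', hx]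
  -- the image `A` of `R'` in `P = R/𝔮R`
  set ψ : R' →+* R ⧸ Iq := (Ideal.Quotient.mk Iq).comp R'.subtype with hψ
  have hψ_apply : ∀ t : R', ψ t = Ideal.Quotient.mk Iq (t : R) := fun t => rfl
  set A : Subring (R ⧸ Iq) := ψ.range with hA
  have hfrobP : (frobenius (R ⧸ Iq) p).range ≤ A := by
    rintro _ ⟨u, rfl⟩
    obtain ⟨y, rfl⟩ := Ideal.Quotient.mk_surjective u
    refine ⟨⟨y ^ p, hR' ⟨y, rfl⟩⟩, ?_⟩
    show Ideal.Quotient.mk Iq (y ^ p) = frobenius (R ⧸ Iq) p (Ideal.Quotient.mk Iq y)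
    rw [frobenius_def, map_pow]
  haveI hAloc : IsLocalRing A := isLocalRing hfrobP
  haveI : CharP A p := (A.subtype).charP Subtype.val_injective p
  have hker : ∀ t : R', ψ t = 0 ↔ t ∈ 𝔮 := by
    intro t
    rw [hψ_apply, Ideal.Quotient.eq_zero_iff_mem, hIq_map]
    change algebraMap R' R t ∈ _ ↔ _
    rw [← Ideal.mem_comap, Ideal.comap_map_eq_self_of_faithfullyFlat]
  have hψ_surjA : ∀ a : A, ∃ t : R', ψ t = a := fun a => RingHom.mem_range.mp a.2
  have hmA : ∀ a : A, a ∈ maximalIdeal A ↔ (a : R ⧸ Iq) ∈ maximalIdeal (R ⧸ Iq) :=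
    mem_maximalIdeal_iff hfrobP
  have hmA' : ∀ t : R', (⟨ψ t, ⟨t, rfl⟩⟩ : A) ∈ maximalIdeal A ↔ t ∈ maximalIdeal R' := by
    intro t
    rw [hmA, mem_maximalIdeal_iff hR' t]
    exact hmP t
  -- nilpotency of the maximal ideals of `P` and `A`
  obtain ⟨N, hN⟩ : ∃ N : ℕ, maximalIdeal R ^ N ≤ Iq := by
    refine Ideal.exists_pow_le_of_le_radical_of_fg ?_ (IsNoetherian.noetherian _)
    rw [← hx, Ideal.span_le]
    rintro _ ⟨i, rfl⟩
    exact ⟨p ^ 1, Ideal.subset_span ⟨i, rfl⟩⟩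
  have hmPN : maximalIdeal (R ⧸ Iq) ^ N = ⊥ := by
    rw [hmP_map, ← Ideal.map_pow, Ideal.map_eq_bot_iff_le_ker, Ideal.mk_ker]
    exact hN
  have hmAmap_le : (maximalIdeal A).map A.subtype ≤ maximalIdeal (R ⧸ Iq) := by
    rw [Ideal.map_le_iff_le_comap]
    intro a ha
    exact (hmA a).mp ha
  have hmAN : maximalIdeal A ^ N = ⊥ := by
    rw [eq_bot_iff]
    intro a ha
    have h1 : (a : R ⧸ Iq) ∈ ((maximalIdeal A) ^ N).map A.subtype := Ideal.mem_map_of_mem _ ha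
    rw [Ideal.map_pow] at h1
    have h2 := Ideal.pow_right_mono hmAmap_le N h1
    rw [hmPN, Ideal.mem_bot] at h2
    rw [Ideal.mem_bot]
    exact Subtype.ext h2
  haveI : IsAdicComplete (maximalIdeal A) A := isAdicComplete_of_pow_eq_bot hmAN
  -- a coefficient field `κ` of `A`; it is one of `P` as well (`k = k'`)
  obtain ⟨σ, hσ⟩ :=
    Literature.RingTheory.CompleteLocalRings.exists_ringHom_comp_residue_eq_id_of_charP A p hp'
  letI : Algebra (ResidueField A) A := σ.toAlgebra
  letI : Algebra (ResidueField A) (R ⧸ Iq) := (A.subtype.comp σ).toAlgebra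
  haveI : IsScalarTower (ResidueField A) A (R ⧸ Iq) := IsScalarTower.of_algebraMap_eq (fun c => rfl)
  set κ := ResidueField A with hκ
  have hκ_apply : ∀ c : κ, algebraMap κ (R ⧸ Iq) c = (σ c : R ⧸ Iq) := fun c => rfl
  have h1 : ∀ s : R ⧸ Iq, ∃ c : κ, s - algebraMap κ (R ⧸ Iq) c ∈ maximalIdeal (R ⧸ Iq) := by
    intro s
    obtain ⟨y, rfl⟩ := Ideal.Quotient.mk_surjective s
    obtain ⟨y', hy', hyy'⟩ := hres y
    let a : A := ⟨ψ ⟨y', hy'⟩, ⟨_, rfl⟩⟩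
    refine ⟨residue A a, ?_⟩
    have h2 : σ (residue A a) - a ∈ maximalIdeal A := by
      rw [← IsLocalRing.residue_eq_zero_iff, map_sub, hσ, sub_self]
    have h3 : ((σ (residue A a) - a : A) : R ⧸ Iq) ∈ maximalIdeal (R ⧸ Iq) := (hmA _).mp h2
    have h4 : Ideal.Quotient.mk Iq y - (a : R ⧸ Iq) ∈ maximalIdeal (R ⧸ Iq) := by
      change Ideal.Quotient.mk Iq y - Ideal.Quotient.mk Iq y' ∈ _
      rw [← map_sub]
      exact (hmP _).mpr hyy'
    have : Ideal.Quotient.mk Iq y - algebraMap κ (R ⧸ Iq) (residue A a) =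
        (Ideal.Quotient.mk Iq y - (a : R ⧸ Iq)) - ((σ (residue A a) - a : A) : R ⧸ Iq) := by
      rw [hκ_apply]
      push_cast
      ring
    rw [this]
    exact sub_mem h4 h3
  -- `dim_κ P = p²` (length count) and finiteness
  haveI : IsLocalHom (algebraMap κ (R ⧸ Iq)) := by
    refine ⟨fun c hc => ?_⟩
    rcases eq_or_ne c 0 with rfl | hc0
    · rw [map_zero] at hc
      exact absurd hc not_isUnit_zero
    · exact isUnit_iff_ne_zero.mpr hc0
  have hsurjκ : Function.Surjective (algebraMap (ResidueField κ) (ResidueField (R ⧸ Iq))) := by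
    intro v
    obtain ⟨s, rfl⟩ := residue_surjective v
    obtain ⟨c, hc⟩ := h1 s
    refine ⟨residue κ c, ?_⟩
    rw [IsLocalRing.ResidueField.algebraMap_residue, eq_comm, ← sub_eq_zero, ← map_sub,
      IsLocalRing.residue_eq_zero_iff]
    exact hc
  have hlenκP : Module.length κ (R ⧸ Iq) = (p ^ 2 : ℕ) := by
    rw [IsLocalRing.length_restrictScalars κ (R ⧸ Iq) (R ⧸ Iq),
      ← Module.length_eq_of_surjective (R := R ⧸ Iq) (S := R) (M := R ⧸ Iq) Ideal.Quotient.mk_surjective,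
      hlen]
    have e : ResidueField κ ≃ₗ[ResidueField κ] ResidueField (R ⧸ Iq) :=
      LinearEquiv.ofBijective (Algebra.linearMap (ResidueField κ) (ResidueField (R ⧸ Iq)))
        ⟨(algebraMap (ResidueField κ) (ResidueField (R ⧸ Iq))).injective, hsurjκ⟩
    rw [← e.length_eq, Module.length_eq_finrank, Module.finrank_self, Nat.cast_one, mul_one]
  haveI hfinκP : Module.Finite κ (R ⧸ Iq) := by
    have : Module.length κ (R ⧸ Iq) ≠ ⊤ := by rw [hlenκP]; exact ENat.coe_ne_top _
    rw [Module.length_ne_top_iff, isFiniteLength_iff_isNoetherian_isArtinian] at this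
    haveI := this.1
    exact Module.IsNoetherian.finite κ (R ⧸ Iq)
  have hfinrankP : Module.finrank κ (R ⧸ Iq) = p ^ 2 := by
    have := hlenκP
    rw [Module.length_eq_finrank] at this
    exact_mod_cast this
  -- `P` is free over `A`, with basis the image of an `R'`-basis of `R`
  set bR := Module.Free.chooseBasis R' R with hbR
  let eP : Module.Free.ChooseBasisIndex R' R → R ⧸ Iq := fun i => Ideal.Quotient.mk Iq (bR i)
  have hmk_sum : ∀ (t : Module.Free.ChooseBasisIndex R' R → R'),
      Ideal.Quotient.mk Iq (∑ i, t i • bR i) = ∑ i, (⟨ψ (t i), ⟨t i, rfl⟩⟩ : A) • eP i := by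
    intro t
    rw [map_sum]
    refine Finset.sum_congr rfl fun i _ => ?_
    rw [Subring.smul_def, Subring.smul_def, smul_eq_mul, smul_eq_mul, map_mul]
    rfl
  have hli : LinearIndependent A eP := by
    rw [Fintype.linearIndependent_iff]
    intro g hg i
    choose t ht using fun i => hψ_surjA (g i)
    have hg' : ∑ i, (⟨ψ (t i), ⟨t i, rfl⟩⟩ : A) • eP i = 0 := by
      rw [← hg]
      refine Finset.sum_congr rfl fun i _ => ?_
      congr 1
      exact Subtype.ext (ht i)
    rw [← hmk_sum, Ideal.Quotient.eq_zero_iff_mem, hIq_map] at hg'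
    have hti : t i ∈ 𝔮 := by
      have := repr_mem_of_mem_map bR 𝔮 hg' i
      rwa [bR.repr_sum_self] at this
    apply Subtype.ext
    rw [← ht i]
    exact (hker (t i)).mpr hti
  have hsp : ⊤ ≤ Submodule.span A (Set.range eP) := by
    intro u _
    obtain ⟨y, rfl⟩ := Ideal.Quotient.mk_surjective u
    rw [← bR.sum_repr y, hmk_sum]
    exact Submodule.sum_mem _ fun i _ => Submodule.smul_mem _ _ (Submodule.subset_span ⟨i, rfl⟩)
  let bP : Module.Basis (Module.Free.ChooseBasisIndex R' R) A (R ⧸ Iq) := Module.Basis.mk hli hsp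
  haveI : Module.Free A (R ⧸ Iq) := Module.Free.of_basis bP
  haveI : Module.Finite A (R ⧸ Iq) := Module.Finite.of_basis bP
  have hrankAP : Module.finrank A (R ⧸ Iq) = Module.finrank R' R := by
    rw [Module.finrank_eq_card_basis bP, Module.finrank_eq_card_chooseBasisIndex]
  have hmul : Module.finrank κ A * Module.finrank R' R = p ^ 2 := by
    rw [← hrankAP, Module.finrank_mul_finrank, hfinrankP]
  have hfinrankA_pos : 0 < Module.finrank κ A := by
    rcases Nat.eq_zero_or_pos (Module.finrank κ A) with h | h
    · rw [h, zero_mul] at hmul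
      exact absurd hmul.symm (pow_ne_zero 2 hp'.ne_zero)
    · exact h
  haveI : Module.Finite κ A := Module.finite_of_finrank_pos hfinrankA_pos
  -- `P ≅ κ[X₁, X₂]/(X₁^p, X₂^p)`
  haveI : CharP κ p := charP_quotient_of_ne_top' (maximalIdeal A) (maximalIdeal.isMaximal A).ne_top
  let zb : Fin n → R ⧸ Iq := fun i => Ideal.Quotient.mk Iq (x i)
  let φ : MvPolynomial (Fin n) κ →ₐ[κ] R ⧸ Iq := MvPolynomial.aeval zb
  have hφI : ∀ a ∈ TruncPoly.frobIdeal κ p n, φ a = 0 := by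
    have hle : TruncPoly.frobIdeal κ p n ≤ RingHom.ker φ := by
      rw [TruncPoly.frobIdeal, Ideal.span_le]
      rintro _ ⟨i, rfl⟩
      rw [SetLike.mem_coe, RingHom.mem_ker]
      change φ (MvPolynomial.X i ^ p) = 0
      rw [map_pow, MvPolynomial.aeval_X, ← map_pow, Ideal.Quotient.eq_zero_iff_mem]
      refine Ideal.subset_span ⟨i, ?_⟩
      simp only [pow_one]
    exact fun a ha => hle ha
  let φq : TruncPoly.Alg κ p n →ₐ[κ] R ⧸ Iq := Ideal.Quotient.liftₐ (TruncPoly.frobIdeal κ p n) φ hφI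
  have hφq_mk : ∀ g, φq (Ideal.Quotient.mk _ g) = φ g := fun g => rfl
  have hsubmod : (⊤ : Submodule κ (R ⧸ Iq)) ≤ (Algebra.adjoin κ (Set.range zb)).toSubmodule := by
    have htop := top_le_sup_span_pow_sup_pow (R := κ) (maximalIdeal (R ⧸ Iq)) (Set.range zb) hmP_eq h1 N
    have hbot : (maximalIdeal (R ⧸ Iq)) ^ (N + 1) = ⊥ := by
      rw [eq_bot_iff, ← hmPN]
      exact Ideal.pow_le_pow_right (Nat.le_succ N)
    rw [hbot, Submodule.restrictScalars_bot, sup_bot_eq] at htop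
    have hpow : ∀ j : ℕ, Submodule.span κ (Set.range zb) ^ j ≤ (Algebra.adjoin κ (Set.range zb)).toSubmodule := by
      intro j
      induction j with
      | zero =>
        rw [pow_zero, Submodule.one_le]
        exact Subalgebra.one_mem _
      | succ j ih =>
        rw [pow_succ, Submodule.mul_le]
        intro a ha b hb
        have hb' : b ∈ (Algebra.adjoin κ (Set.range zb)).toSubmodule :=
          (Submodule.span_le.mpr (Algebra.subset_adjoin (R := κ) (s := Set.range zb))) hb
        exact Subalgebra.mul_mem _ (ih ha) hb'
    exact htop.trans (Finset.sup_le fun j _ => hpow j)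
  have hadj : Algebra.adjoin κ (Set.range zb) = ⊤ := by
    rw [eq_top_iff]
    intro v _
    exact hsubmod Submodule.mem_top
  have hφ_surj : Function.Surjective φ := by
    rw [← AlgHom.range_eq_top, ← Algebra.adjoin_range_eq_range_aeval, hadj]
  have hφq_surj : Function.Surjective φq := by
    intro v
    obtain ⟨g, rfl⟩ := hφ_surj v
    exact ⟨Ideal.Quotient.mk _ g, rfl⟩
  haveI : Module.Finite κ (TruncPoly.Alg κ p n) := TruncPoly.finite_alg
  have hφq_inj : Function.Injective φq := by
    have hdimeq : Module.finrank κ (TruncPoly.Alg κ p n) = Module.finrank κ (R ⧸ Iq) := by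
      rw [TruncPoly.finrank_alg, hfinrankP, hr2]
    exact (LinearMap.injective_iff_surjective_of_finrank_eq_finrank hdimeq (f := φq.toLinearMap)).mpr
      hφq_surj
  let Φ : TruncPoly.Alg κ p n ≃ₐ[κ] R ⧸ Iq := AlgEquiv.ofBijective φq ⟨hφq_inj, hφq_surj⟩
  -- the transported partial derivatives
  let E : Fin n → R ⧸ Iq → R ⧸ Iq := fun i u => Φ (TruncPoly.D κ p n i (Φ.symm u))
  have hEadd : ∀ i u v, E i (u + v) = E i u + E i v := by
    intro i u v
    simp only [E, map_add]
  have hEmul : ∀ i u v, E i (u * v) = u * E i v + v * E i u := by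
    intro i u v
    simp only [E]
    rw [map_mul, TruncPoly.D_mul, map_add, map_mul, map_mul, AlgEquiv.apply_symm_apply,
      AlgEquiv.apply_symm_apply]
  have hsimple : ∀ J : Ideal (R ⧸ Iq), J ≠ ⊥ → (∀ i, ∀ u ∈ J, E i u ∈ J) → J = ⊤ := by
    intro J hJ hstab
    set J' : Ideal (TruncPoly.Alg κ p n) := J.comap Φ with hJ'
    have hJ'ne : J' ≠ ⊥ := by
      obtain ⟨v, hvJ, hv0⟩ := J.ne_bot_iff.mp hJ
      rw [Ne, Ideal.ext_iff, not_forall] -- placeholder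
      refine ⟨Φ.symm v, fun h => hv0 ?_⟩
      have : Φ.symm v ∈ J' := by
        change Φ (Φ.symm v) ∈ J
        rw [AlgEquiv.apply_symm_apply]; exact hvJ
      have h0 : Φ.symm v = 0 := by simpa [Ideal.mem_bot] using (h.mp this)
      rw [← AlgEquiv.apply_symm_apply Φ v, h0, map_zero]
    have hJ'stab : ∀ i, ∀ u ∈ J', TruncPoly.D κ p n i u ∈ J' := by
      intro i u hu
      change Φ (TruncPoly.D κ p n i u) ∈ J
      have := hstab i (Φ u) hu
      simpa only [E, AlgEquiv.symm_apply_apply] using this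
    have hJ'top := TruncPoly.ideal_eq_top_of_forall_D_mem J' hJ'ne hJ'stab
    rw [eq_top_iff]
    intro v _
    have : Φ.symm v ∈ J' := hJ'top ▸ Submodule.mem_top
    change Φ (Φ.symm v) ∈ J at this
    rwa [AlgEquiv.apply_symm_apply] at this
  -- `𝔫_A P` is a proper ideal; the differential step
  have hJtop : (maximalIdeal A).map A.subtype ≠ ⊤ := fun h =>
    (maximalIdeal.isMaximal (R ⧸ Iq)).ne_top (top_le_iff.mp (h ▸ hmAmap_le))
  have hfun2 : (⇑(frobenius R p) ∘ x) = fun i => x i ^ p ^ 1 := by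
    funext i
    simp [frobenius_def]
  have hIq_frob : (Ideal.span (Set.range x)).map (frobenius R p) = Iq := by
    rw [Ideal.map_span, ← Set.range_comp, hfun2]
  -- CLAIM: `𝔪' ⊆ yR' + 𝔮` for some `y ∈ 𝔪'`
  have hclaim : ∃ y ∈ maximalIdeal R', ∀ t ∈ maximalIdeal R', ∃ c : R', t - c * y ∈ 𝔮 := by
    by_cases hJ0 : (maximalIdeal A).map A.subtype = ⊥
    · refine ⟨0, zero_mem _, fun t ht => ⟨0, ?_⟩⟩
      rw [zero_mul, sub_zero, ← hker]
      have hta : (⟨ψ t, ⟨t, rfl⟩⟩ : A) ∈ maximalIdeal A := (hmA' t).mpr ht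
      have : ((⟨ψ t, ⟨t, rfl⟩⟩ : A) : R ⧸ Iq) ∈ (maximalIdeal A).map A.subtype :=
        Ideal.mem_map_of_mem _ hta
      rw [hJ0, Ideal.mem_bot] at this
      exact this
    · obtain ⟨a, ha, hap⟩ := exists_pow_ne_zero_of_dsimple A bP E hEadd hEmul hsimple hJtop hJ0
      obtain ⟨y, hy⟩ := hψ_surjA a
      have hya : (⟨ψ y, ⟨y, rfl⟩⟩ : A) = a := Subtype.ext hy
      have hym : y ∈ maximalIdeal R' := (hmA' y).mp (by rw [hya]; exact ha)
      -- `a^p = 0`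
      have hap0 : a ^ p = 0 := by
        apply Subtype.ext
        rw [SubmonoidClass.coe_pow, ZeroMemClass.coe_zero, ← hy, hψ_apply, ← map_pow,
          Ideal.Quotient.eq_zero_iff_mem, ← hIq_frob]
        have hyR : (y : R) ∈ Ideal.span (Set.range x) := by
          rw [hx]; exact (mem_maximalIdeal_iff hR' y).mp hym
        have := Ideal.mem_map_of_mem (frobenius R p) hyR
        rwa [frobenius_def] at this
      -- the powers `1, a, …, a^{p-1}` are `κ`-independent
      have hli_a : LinearIndependent κ (fun j : Fin p => a ^ (j : ℕ)) :=
        linearIndependent_pow_of_pow_eq_zero hap0 hap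
      have hcard : p ≤ Module.finrank κ A := by
        have := hli_a.fintype_card_le_finrank
        simpa using this
      -- counting: `dim_κ A = p`
      have hdA : Module.finrank κ A = p := by
        have hdvd : Module.finrank κ A ∣ p ^ 2 := Dvd.intro _ hmul
        obtain ⟨k, hk, hk'⟩ := (Nat.dvd_prime_pow hp').mp hdvd
        interval_cases k
        · rw [pow_zero] at hk'
          rw [hk'] at hcard
          exact absurd hcard (not_le.mpr hp'.one_lt)
        · rw [hk', pow_one]
        · exfalso
          rw [hk'] at hmul
          apply hne
          apply eq_top_of_finrank_eq_one hR'
          have : p ^ 2 * Module.finrank R' R = p ^ 2 * 1 := by rw [hmul, mul_one]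
          exact Nat.eq_of_mul_eq_mul_left (pow_pos hp'.pos 2) this
      have hspan_a : Submodule.span κ (Set.range fun j : Fin p => a ^ (j : ℕ)) = ⊤ :=
        hli_a.span_eq_top_of_card_eq_finrank (by rw [Fintype.card_fin, hdA])
      -- `𝔫_A = aA`
      have hnA : ∀ b ∈ maximalIdeal A, b ∈ Ideal.span {a} := fun b hb =>
        mem_span_singleton_of_span_pow_eq_top ha hspan_a hb
      refine ⟨y, hym, fun t ht => ?_⟩
      have hta : (⟨ψ t, ⟨t, rfl⟩⟩ : A) ∈ maximalIdeal A := (hmA' t).mpr ht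
      obtain ⟨e, he⟩ := Ideal.mem_span_singleton'.mp (hnA _ hta)
      obtain ⟨c, hc⟩ := hψ_surjA e
      refine ⟨c, (hker _).mp ?_⟩
      have he' : (e : R ⧸ Iq) * (a : R ⧸ Iq) = ψ t := by
        have := congrArg Subtype.val he
        simpa only [Subring.coe_mul] using this
      rw [map_sub, map_mul, hc, hy, he', sub_self]
  -- final count: `𝔪'` needs `dim R' = 2` generators
  obtain ⟨y, hym, hC⟩ := hclaim
  by_contra hall
  push Not at hall
  have h𝔮le : 𝔮 ≤ maximalIdeal R' ^ 2 := by
    rw [h𝔮, Ideal.span_le]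
    rintro _ ⟨i, rfl⟩
    exact hall (x i) (hxm i)
  have hm'le : maximalIdeal R' ≤ Ideal.span {y} ⊔ maximalIdeal R' • maximalIdeal R' := by
    intro t ht
    obtain ⟨c, hc⟩ := hC t ht
    have : t = c * y + (t - c * y) := by ring
    rw [this]
    refine Submodule.add_mem_sup (Ideal.mul_mem_left _ _ (Ideal.mem_span_singleton_self y)) ?_
    have := h𝔮le hc
    rwa [pow_two] at this
  have hNak := Submodule.le_of_le_smul_of_le_jacobson_bot (IsNoetherian.noetherian _)
    (IsLocalRing.maximalIdeal_le_jacobson _) hm'le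
  have hsf : (maximalIdeal R').spanFinrank ≤ 1 := by
    have heq : maximalIdeal R' = Ideal.span {y} :=
      le_antisymm hNak ((Ideal.span_singleton_le_iff_mem _).mpr hym)
    rw [heq]
    have := Submodule.spanFinrank_span_le_ncard_of_finite (R := R') (Set.finite_singleton y)
    simpa using this
  have hdimR' : (maximalIdeal R').spanFinrank = 2 := by
    have e := IsRegularLocalRing.spanFinrank_maximalIdeal (R := R')
    rw [ringKrullDim_eq hR', hdim] at e
    exact_mod_cast e
  omega

/-- The Lemma-5 input for `dim R ≤ 2` (dimension `≤ 1`: `lemma5_of_ringKrullDim_le_one`; dimension `2`: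
`lemma5_of_ringKrullDim_eq_two`). [cite: KimuraNiitsuma1982, Lemma 5 p. 376] -/
theorem lemma5_of_ringKrullDim_le_two [IsRegularLocalRing R] (hR' : (frobenius R p).range ≤ R')
    (hreg : IsRegularLocalRing R') [Module.Finite R' R] (hdim : ringKrullDim R ≤ 2) (hne : R' ≠ ⊤)
    (hres : ∀ x : R, ∃ x' ∈ R', x - x' ∈ maximalIdeal R)
    (hsq : ∀ x ∈ R', x ∈ maximalIdeal R → x ∈ maximalIdeal R ^ 2) :
    ∃ z ∈ maximalIdeal R, (⟨z ^ p, hR' ⟨z, rfl⟩⟩ : R') ∉ maximalIdeal R' ^ 2 := by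
  obtain ⟨d, hd⟩ := exists_nat_cast_eq_ringKrullDim (R := R)
  have hd2 : d ≤ 2 := by
    rw [hd] at hdim
    exact_mod_cast hdim
  by_cases hd1 : d ≤ 1
  · exact lemma5_of_ringKrullDim_le_one hR' hreg (by rw [hd]; exact_mod_cast hd1) hne hres hsq
  · have : d = 2 := by omega
    subst this
    exact lemma5_of_ringKrullDim_eq_two hR' hreg (by rw [hd]; rfl) hne hres

/-- **Kimura–Niitsuma 1982 THEOREM §3 (Kunz's conjecture), UNCONDITIONAL for `dim R ≤ 2` (any rank).** A regular
local ring `R` of characteristic `p` and dimension `≤ 2`, module-finite over a regular local subring `R' ⊇ R^p`,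
has a `p`-basis over `R'`: the bounded assembly `exists_isPBasisOver_of_lemma5_le` needs the Lemma-5 input only
in dimension `≤ 2`, where it is `lemma5_of_ringKrullDim_le_two`. [cite: KimuraNiitsuma1982, Theorem §3 p. 375] -/
theorem exists_isPBasisOver_of_ringKrullDim_le_two [IsRegularLocalRing R] (hR' : (frobenius R p).range ≤ R')
    (hreg : IsRegularLocalRing R') [Module.Finite R' R] (hdim : ringKrullDim R ≤ 2) :
    ∃ Γ : Set R, IsPBasisOver p R' Γ :=
  exists_isPBasisOver_of_lemma5_le 2 (Module.finrank R' R)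
    (fun R _ _ _ R' _ hR' _ hD _ hne hres hsq =>
      lemma5_of_ringKrullDim_le_two (R := R) (R' := R') hR' ‹_› (by exact_mod_cast hD) hne hres hsq)
    hR' hreg (by exact_mod_cast hdim) le_rfl

set_option maxHeartbeats 1600000 in
/-- **KN 1982 Lemma 5 (the input of the THEOREM) in EVERY dimension, from HARPER'S THEOREM.** The hypothesis
`hH` is (a consequence of) Harper's theorem = Corollary 2.8 of S. Yuan [9] as used on p. 376 l. 6–7 («`R̃'` is a
differentiably simple ring. And so by Corollary 2.8 of [9], `R̃'` has a `p`-basis over `k^p`»): a local Artinian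
algebra `A`, finite over a coefficient field `κ` of characteristic `p`, with `a^p = 0` on `𝔫_A`, in which every
nonzero proper ideal is moved by some `κ`-derivation, is a truncated polynomial ring `κ[T₁,…,T_e]/(Tᵢ^p)`; we only
use: `𝔫_A` is generated by `e` elements with `p^e = dim_κ A`. Given that, the dimension-two route of
`lemma5_of_ringKrullDim_eq_two` runs verbatim in dimension `n`: `p^e · rank_{R'} R = p^n` and `R' ≠ R` give
`e < n`, `𝔪' ⊆ (t₁, …, t_e)R' + 𝔮`, and as `𝔪'` needs `n` generators some `xᵢ^p ∉ 𝔪'²`. (Completion, the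
`k̄`-base change and Yuan's `Hom_{R^p}(R,R) = R[D]` of the printed proof are not needed on this route.)
[cite: KimuraNiitsuma1982, Lemma 5 p. 376; §3 p. 375–376] -/
theorem lemma5_of_harper
    (hH : ∀ (A : Type u) [CommRing A] [IsLocalRing A] [CharP A p] (κ : Type u) [Field κ] [Algebra κ A]
      [Module.Finite κ A],
      (∀ a : A, ∃ c : κ, a - algebraMap κ A c ∈ maximalIdeal A) →
      (∀ a ∈ maximalIdeal A, a ^ p = 0) →
      (∀ I : Ideal A, I ≠ ⊥ → I ≠ ⊤ → ∃ δ : A → A, (∀ b c, δ (b + c) = δ b + δ c) ∧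
          (∀ b c, δ (b * c) = b * δ c + c * δ b) ∧ (∀ c : κ, δ (algebraMap κ A c) = 0) ∧
          ∃ b ∈ I, δ b ∉ I) →
      ∃ (e : ℕ) (y : Fin e → A), Ideal.span (Set.range y) = maximalIdeal A ∧ p ^ e = Module.finrank κ A)
    [IsRegularLocalRing R] (hR' : (frobenius R p).range ≤ R')
    (hreg : IsRegularLocalRing R') [Module.Finite R' R] (hne : R' ≠ ⊤)
    (hres : ∀ x : R, ∃ x' ∈ R', x - x' ∈ maximalIdeal R) :
    ∃ z ∈ maximalIdeal R, (⟨z ^ p, hR' ⟨z, rfl⟩⟩ : R') ∉ maximalIdeal R' ^ 2 := by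
  classical
  haveI := hreg
  have hp' : p.Prime := hp.out
  haveI : IsDomain R := isDomain_of_isRegularLocalRing R
  haveI := isLocalHom_algebraMap hR'
  haveI : Module.Free R' R := free hR' hreg
  haveI : Nontrivial R' := R'.subtype.domain_nontrivial
  -- a regular system of parameters
  obtain ⟨n, x, hx, hn⟩ : ∃ (n : ℕ) (x : Fin n → R), Ideal.span (Set.range x) = maximalIdeal R ∧
      (maximalIdeal R).spanFinrank = n :=
    ⟨_, (Kunz1969.exists_span_range_eq (maximalIdeal R)).choose,
      (Kunz1969.exists_span_range_eq (maximalIdeal R)).choose_spec, rfl⟩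
  have hxm : ∀ i, x i ∈ maximalIdeal R := fun i => by
    rw [← hx]; exact Ideal.subset_span ⟨i, rfl⟩
  -- the ideals `𝔮 = (xᵢ^p) R'` and `𝔮R`
  set xp' : Fin n → R' := fun i => ⟨x i ^ p, hR' ⟨x i, rfl⟩⟩ with hxp'
  set 𝔮 : Ideal R' := Ideal.span (Set.range xp') with h𝔮
  set Iq : Ideal R := Ideal.span (Set.range fun i => x i ^ p ^ 1) with hIq_def
  have hfun : (fun i => x i ^ p ^ 1) = (algebraMap R' R) ∘ xp' := by
    funext i
    rw [pow_one]
    rfl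
  have hIq_map : Iq = 𝔮.map (algebraMap R' R) := by
    rw [hIq_def, h𝔮, Ideal.map_span, ← Set.range_comp, hfun]
  have hlen : Module.length R (R ⧸ Iq) = (p ^ n : ℕ) := by
    have := Kunz1969.length_quotient_frobeniusPower_eq (flat_frobenius_of_isRegularLocalRing p R) x hx
      hn 1
    rw [this, pow_one]
  have hIq_le : Iq ≤ maximalIdeal R := by
    rw [hIq_def, Ideal.span_le]
    rintro _ ⟨i, rfl⟩
    exact Ideal.pow_mem_of_mem _ (hxm i) _ (pow_pos hp'.pos 1)
  have hIq_ne : Iq ≠ ⊤ := fun h => (maximalIdeal.isMaximal R).ne_top (top_le_iff.mp (h ▸ hIq_le))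
  haveI : Nontrivial (R ⧸ Iq) := Ideal.Quotient.nontrivial_iff.mpr hIq_ne
  haveI : IsLocalRing (R ⧸ Iq) :=
    IsLocalRing.of_surjective' (Ideal.Quotient.mk Iq) Ideal.Quotient.mk_surjective
  haveI hcharP : CharP (R ⧸ Iq) p := charP_quotient_of_ne_top' Iq hIq_ne
  -- maximal ideal of `P = R/𝔮R`
  have hmP : ∀ y : R, Ideal.Quotient.mk Iq y ∈ maximalIdeal (R ⧸ Iq) ↔ y ∈ maximalIdeal R := by
    intro y
    rw [IsLocalRing.mem_maximalIdeal, IsLocalRing.mem_maximalIdeal, mem_nonunits_iff,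
      mem_nonunits_iff, not_iff_not]
    constructor
    · intro hu
      obtain ⟨v, hv⟩ := hu.exists_left_inv
      obtain ⟨w, rfl⟩ := Ideal.Quotient.mk_surjective v
      rw [← map_mul, ← (Ideal.Quotient.mk Iq).map_one, Ideal.Quotient.mk_eq_mk_iff_sub_mem] at hv
      by_contra hy
      have h1 : w * y - 1 ∈ maximalIdeal R := hIq_le hv
      have h2 : w * y ∈ maximalIdeal R := Ideal.mul_mem_left _ _ ((IsLocalRing.mem_maximalIdeal _).mpr hy)
      have : (1 : R) ∈ maximalIdeal R := by
        have := sub_mem h2 h1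
        rwa [sub_sub_cancel] at this
      exact (maximalIdeal.isMaximal R).ne_top (Ideal.eq_top_of_isUnit_mem _ this isUnit_one)
    · exact fun hu => hu.map _
  have hmP_eq : maximalIdeal (R ⧸ Iq) = Ideal.span (Set.range fun i => Ideal.Quotient.mk Iq (x i)) := by
    apply le_antisymm
    · intro u hu
      obtain ⟨y, rfl⟩ := Ideal.Quotient.mk_surjective u
      have hy : y ∈ Ideal.span (Set.range x) := by rw [hx]; exact (hmP y).mp hu
      have hspan : Ideal.span (Set.range fun i => Ideal.Quotient.mk Iq (x i)) =
          (Ideal.span (Set.range x)).map (Ideal.Quotient.mk Iq) := by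
        rw [Ideal.map_span, ← Set.range_comp]
        rfl
      rw [hspan]
      exact Ideal.mem_map_of_mem _ hy
    · rw [Ideal.span_le]
      rintro _ ⟨i, rfl⟩
      exact (hmP _).mpr (hxm i)
  have hmap' : (Ideal.span (Set.range x)).map (Ideal.Quotient.mk Iq) =
      Ideal.span (Set.range fun i => Ideal.Quotient.mk Iq (x i)) := by
    rw [Ideal.map_span, ← Set.range_comp]
    rfl
  have hmP_map : maximalIdeal (R ⧸ Iq) = (maximalIdeal R).map (Ideal.Quotient.mk Iq) := by
    rw [hmP_eq, ← hmap', hx]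
  -- the image `A` of `R'` in `P = R/𝔮R`
  set ψ : R' →+* R ⧸ Iq := (Ideal.Quotient.mk Iq).comp R'.subtype with hψ
  have hψ_apply : ∀ t : R', ψ t = Ideal.Quotient.mk Iq (t : R) := fun t => rfl
  set A : Subring (R ⧸ Iq) := ψ.range with hA
  have hfrobP : (frobenius (R ⧸ Iq) p).range ≤ A := by
    rintro _ ⟨u, rfl⟩
    obtain ⟨y, rfl⟩ := Ideal.Quotient.mk_surjective u
    refine ⟨⟨y ^ p, hR' ⟨y, rfl⟩⟩, ?_⟩
    show Ideal.Quotient.mk Iq (y ^ p) = frobenius (R ⧸ Iq) p (Ideal.Quotient.mk Iq y)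
    rw [frobenius_def, map_pow]
  haveI hAloc : IsLocalRing A := isLocalRing hfrobP
  haveI : CharP A p := (A.subtype).charP Subtype.val_injective p
  have hker : ∀ t : R', ψ t = 0 ↔ t ∈ 𝔮 := by
    intro t
    rw [hψ_apply, Ideal.Quotient.eq_zero_iff_mem, hIq_map]
    change algebraMap R' R t ∈ _ ↔ _
    rw [← Ideal.mem_comap, Ideal.comap_map_eq_self_of_faithfullyFlat]
  have hψ_surjA : ∀ a : A, ∃ t : R', ψ t = a := fun a => RingHom.mem_range.mp a.2
  have hmA : ∀ a : A, a ∈ maximalIdeal A ↔ (a : R ⧸ Iq) ∈ maximalIdeal (R ⧸ Iq) :=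
    mem_maximalIdeal_iff hfrobP
  have hmA' : ∀ t : R', (⟨ψ t, ⟨t, rfl⟩⟩ : A) ∈ maximalIdeal A ↔ t ∈ maximalIdeal R' := by
    intro t
    rw [hmA, mem_maximalIdeal_iff hR' t]
    exact hmP t
  -- nilpotency of the maximal ideals of `P` and `A`
  obtain ⟨N, hN⟩ : ∃ N : ℕ, maximalIdeal R ^ N ≤ Iq := by
    refine Ideal.exists_pow_le_of_le_radical_of_fg ?_ (IsNoetherian.noetherian _)
    rw [← hx, Ideal.span_le]
    rintro _ ⟨i, rfl⟩
    exact ⟨p ^ 1, Ideal.subset_span ⟨i, rfl⟩⟩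
  have hmPN : maximalIdeal (R ⧸ Iq) ^ N = ⊥ := by
    rw [hmP_map, ← Ideal.map_pow, Ideal.map_eq_bot_iff_le_ker, Ideal.mk_ker]
    exact hN
  have hmAmap_le : (maximalIdeal A).map A.subtype ≤ maximalIdeal (R ⧸ Iq) := by
    rw [Ideal.map_le_iff_le_comap]
    intro a ha
    exact (hmA a).mp ha
  have hmAN : maximalIdeal A ^ N = ⊥ := by
    rw [eq_bot_iff]
    intro a ha
    have h1 : (a : R ⧸ Iq) ∈ ((maximalIdeal A) ^ N).map A.subtype := Ideal.mem_map_of_mem _ ha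
    rw [Ideal.map_pow] at h1
    have h2 := Ideal.pow_right_mono hmAmap_le N h1
    rw [hmPN, Ideal.mem_bot] at h2
    rw [Ideal.mem_bot]
    exact Subtype.ext h2
  haveI : IsAdicComplete (maximalIdeal A) A := isAdicComplete_of_pow_eq_bot hmAN
  -- a coefficient field `κ` of `A`; it is one of `P` as well (`k = k'`)
  obtain ⟨σ, hσ⟩ :=
    Literature.RingTheory.CompleteLocalRings.exists_ringHom_comp_residue_eq_id_of_charP A p hp'
  letI : Algebra (ResidueField A) A := σ.toAlgebra
  letI : Algebra (ResidueField A) (R ⧸ Iq) := (A.subtype.comp σ).toAlgebra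
  haveI : IsScalarTower (ResidueField A) A (R ⧸ Iq) := IsScalarTower.of_algebraMap_eq (fun c => rfl)
  set κ := ResidueField A with hκ
  have hκ_apply : ∀ c : κ, algebraMap κ (R ⧸ Iq) c = (σ c : R ⧸ Iq) := fun c => rfl
  have h1 : ∀ s : R ⧸ Iq, ∃ c : κ, s - algebraMap κ (R ⧸ Iq) c ∈ maximalIdeal (R ⧸ Iq) := by
    intro s
    obtain ⟨y, rfl⟩ := Ideal.Quotient.mk_surjective s
    obtain ⟨y', hy', hyy'⟩ := hres y
    let a : A := ⟨ψ ⟨y', hy'⟩, ⟨_, rfl⟩⟩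
    refine ⟨residue A a, ?_⟩
    have h2 : σ (residue A a) - a ∈ maximalIdeal A := by
      rw [← IsLocalRing.residue_eq_zero_iff, map_sub, hσ, sub_self]
    have h3 : ((σ (residue A a) - a : A) : R ⧸ Iq) ∈ maximalIdeal (R ⧸ Iq) := (hmA _).mp h2
    have h4 : Ideal.Quotient.mk Iq y - (a : R ⧸ Iq) ∈ maximalIdeal (R ⧸ Iq) := by
      change Ideal.Quotient.mk Iq y - Ideal.Quotient.mk Iq y' ∈ _
      rw [← map_sub]
      exact (hmP _).mpr hyy'
    have : Ideal.Quotient.mk Iq y - algebraMap κ (R ⧸ Iq) (residue A a) =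
        (Ideal.Quotient.mk Iq y - (a : R ⧸ Iq)) - ((σ (residue A a) - a : A) : R ⧸ Iq) := by
      rw [hκ_apply]
      push_cast
      ring
    rw [this]
    exact sub_mem h4 h3
  -- `dim_κ P = p²` (length count) and finiteness
  haveI : IsLocalHom (algebraMap κ (R ⧸ Iq)) := by
    refine ⟨fun c hc => ?_⟩
    rcases eq_or_ne c 0 with rfl | hc0
    · rw [map_zero] at hc
      exact absurd hc not_isUnit_zero
    · exact isUnit_iff_ne_zero.mpr hc0
  have hsurjκ : Function.Surjective (algebraMap (ResidueField κ) (ResidueField (R ⧸ Iq))) := by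
    intro v
    obtain ⟨s, rfl⟩ := residue_surjective v
    obtain ⟨c, hc⟩ := h1 s
    refine ⟨residue κ c, ?_⟩
    rw [IsLocalRing.ResidueField.algebraMap_residue, eq_comm, ← sub_eq_zero, ← map_sub,
      IsLocalRing.residue_eq_zero_iff]
    exact hc
  have hlenκP : Module.length κ (R ⧸ Iq) = (p ^ n : ℕ) := by
    rw [IsLocalRing.length_restrictScalars κ (R ⧸ Iq) (R ⧸ Iq),
      ← Module.length_eq_of_surjective (R := R ⧸ Iq) (S := R) (M := R ⧸ Iq) Ideal.Quotient.mk_surjective,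
      hlen]
    have e : ResidueField κ ≃ₗ[ResidueField κ] ResidueField (R ⧸ Iq) :=
      LinearEquiv.ofBijective (Algebra.linearMap (ResidueField κ) (ResidueField (R ⧸ Iq)))
        ⟨(algebraMap (ResidueField κ) (ResidueField (R ⧸ Iq))).injective, hsurjκ⟩
    rw [← e.length_eq, Module.length_eq_finrank, Module.finrank_self, Nat.cast_one, mul_one]
  haveI hfinκP : Module.Finite κ (R ⧸ Iq) := by
    have : Module.length κ (R ⧸ Iq) ≠ ⊤ := by rw [hlenκP]; exact ENat.coe_ne_top _
    rw [Module.length_ne_top_iff, isFiniteLength_iff_isNoetherian_isArtinian] at this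
    haveI := this.1
    exact Module.IsNoetherian.finite κ (R ⧸ Iq)
  have hfinrankP : Module.finrank κ (R ⧸ Iq) = p ^ n := by
    have := hlenκP
    rw [Module.length_eq_finrank] at this
    exact_mod_cast this
  -- `P` is free over `A`, with basis the image of an `R'`-basis of `R`
  set bR := Module.Free.chooseBasis R' R with hbR
  let eP : Module.Free.ChooseBasisIndex R' R → R ⧸ Iq := fun i => Ideal.Quotient.mk Iq (bR i)
  have hmk_sum : ∀ (t : Module.Free.ChooseBasisIndex R' R → R'),
      Ideal.Quotient.mk Iq (∑ i, t i • bR i) = ∑ i, (⟨ψ (t i), ⟨t i, rfl⟩⟩ : A) • eP i := by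
    intro t
    rw [map_sum]
    refine Finset.sum_congr rfl fun i _ => ?_
    rw [Subring.smul_def, Subring.smul_def, smul_eq_mul, smul_eq_mul, map_mul]
    rfl
  have hli : LinearIndependent A eP := by
    rw [Fintype.linearIndependent_iff]
    intro g hg i
    choose t ht using fun i => hψ_surjA (g i)
    have hg' : ∑ i, (⟨ψ (t i), ⟨t i, rfl⟩⟩ : A) • eP i = 0 := by
      rw [← hg]
      refine Finset.sum_congr rfl fun i _ => ?_
      congr 1
      exact Subtype.ext (ht i)
    rw [← hmk_sum, Ideal.Quotient.eq_zero_iff_mem, hIq_map] at hg'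
    have hti : t i ∈ 𝔮 := by
      have := repr_mem_of_mem_map bR 𝔮 hg' i
      rwa [bR.repr_sum_self] at this
    apply Subtype.ext
    rw [← ht i]
    exact (hker (t i)).mpr hti
  have hsp : ⊤ ≤ Submodule.span A (Set.range eP) := by
    intro u _
    obtain ⟨y, rfl⟩ := Ideal.Quotient.mk_surjective u
    rw [← bR.sum_repr y, hmk_sum]
    exact Submodule.sum_mem _ fun i _ => Submodule.smul_mem _ _ (Submodule.subset_span ⟨i, rfl⟩)
  let bP : Module.Basis (Module.Free.ChooseBasisIndex R' R) A (R ⧸ Iq) := Module.Basis.mk hli hsp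
  haveI : Module.Free A (R ⧸ Iq) := Module.Free.of_basis bP
  haveI : Module.Finite A (R ⧸ Iq) := Module.Finite.of_basis bP
  have hrankAP : Module.finrank A (R ⧸ Iq) = Module.finrank R' R := by
    rw [Module.finrank_eq_card_basis bP, Module.finrank_eq_card_chooseBasisIndex]
  have hmul : Module.finrank κ A * Module.finrank R' R = p ^ n := by
    rw [← hrankAP, Module.finrank_mul_finrank, hfinrankP]
  have hfinrankA_pos : 0 < Module.finrank κ A := by
    rcases Nat.eq_zero_or_pos (Module.finrank κ A) with h | h
    · rw [h, zero_mul] at hmul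
      exact absurd hmul.symm (pow_ne_zero n hp'.ne_zero)
    · exact h
  haveI : Module.Finite κ A := Module.finite_of_finrank_pos hfinrankA_pos
  -- `P ≅ κ[X₁, X₂]/(X₁^p, X₂^p)`
  haveI : CharP κ p := charP_quotient_of_ne_top' (maximalIdeal A) (maximalIdeal.isMaximal A).ne_top
  let zb : Fin n → R ⧸ Iq := fun i => Ideal.Quotient.mk Iq (x i)
  let φ : MvPolynomial (Fin n) κ →ₐ[κ] R ⧸ Iq := MvPolynomial.aeval zb
  have hφI : ∀ a ∈ TruncPoly.frobIdeal κ p n, φ a = 0 := by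
    have hle : TruncPoly.frobIdeal κ p n ≤ RingHom.ker φ := by
      rw [TruncPoly.frobIdeal, Ideal.span_le]
      rintro _ ⟨i, rfl⟩
      rw [SetLike.mem_coe, RingHom.mem_ker]
      change φ (MvPolynomial.X i ^ p) = 0
      rw [map_pow, MvPolynomial.aeval_X, ← map_pow, Ideal.Quotient.eq_zero_iff_mem]
      refine Ideal.subset_span ⟨i, ?_⟩
      simp only [pow_one]
    exact fun a ha => hle ha
  let φq : TruncPoly.Alg κ p n →ₐ[κ] R ⧸ Iq := Ideal.Quotient.liftₐ (TruncPoly.frobIdeal κ p n) φ hφI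
  have hφq_mk : ∀ g, φq (Ideal.Quotient.mk _ g) = φ g := fun g => rfl
  have hsubmod : (⊤ : Submodule κ (R ⧸ Iq)) ≤ (Algebra.adjoin κ (Set.range zb)).toSubmodule := by
    have htop := top_le_sup_span_pow_sup_pow (R := κ) (maximalIdeal (R ⧸ Iq)) (Set.range zb) hmP_eq h1 N
    have hbot : (maximalIdeal (R ⧸ Iq)) ^ (N + 1) = ⊥ := by
      rw [eq_bot_iff, ← hmPN]
      exact Ideal.pow_le_pow_right (Nat.le_succ N)
    rw [hbot, Submodule.restrictScalars_bot, sup_bot_eq] at htop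
    have hpow : ∀ j : ℕ, Submodule.span κ (Set.range zb) ^ j ≤ (Algebra.adjoin κ (Set.range zb)).toSubmodule := by
      intro j
      induction j with
      | zero =>
        rw [pow_zero, Submodule.one_le]
        exact Subalgebra.one_mem _
      | succ j ih =>
        rw [pow_succ, Submodule.mul_le]
        intro a ha b hb
        have hb' : b ∈ (Algebra.adjoin κ (Set.range zb)).toSubmodule :=
          (Submodule.span_le.mpr (Algebra.subset_adjoin (R := κ) (s := Set.range zb))) hb
        exact Subalgebra.mul_mem _ (ih ha) hb'
    exact htop.trans (Finset.sup_le fun j _ => hpow j)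
  have hadj : Algebra.adjoin κ (Set.range zb) = ⊤ := by
    rw [eq_top_iff]
    intro v _
    exact hsubmod Submodule.mem_top
  have hφ_surj : Function.Surjective φ := by
    rw [← AlgHom.range_eq_top, ← Algebra.adjoin_range_eq_range_aeval, hadj]
  have hφq_surj : Function.Surjective φq := by
    intro v
    obtain ⟨g, rfl⟩ := hφ_surj v
    exact ⟨Ideal.Quotient.mk _ g, rfl⟩
  haveI : Module.Finite κ (TruncPoly.Alg κ p n) := TruncPoly.finite_alg
  have hφq_inj : Function.Injective φq := by
    have hdimeq : Module.finrank κ (TruncPoly.Alg κ p n) = Module.finrank κ (R ⧸ Iq) := by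
      rw [TruncPoly.finrank_alg, hfinrankP]
    exact (LinearMap.injective_iff_surjective_of_finrank_eq_finrank hdimeq (f := φq.toLinearMap)).mpr
      hφq_surj
  let Φ : TruncPoly.Alg κ p n ≃ₐ[κ] R ⧸ Iq := AlgEquiv.ofBijective φq ⟨hφq_inj, hφq_surj⟩
  -- the transported partial derivatives
  let E : Fin n → R ⧸ Iq → R ⧸ Iq := fun i u => Φ (TruncPoly.D κ p n i (Φ.symm u))
  have hEadd : ∀ i u v, E i (u + v) = E i u + E i v := by
    intro i u v
    simp only [E, map_add]
  have hEmul : ∀ i u v, E i (u * v) = u * E i v + v * E i u := by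
    intro i u v
    simp only [E]
    rw [map_mul, TruncPoly.D_mul, map_add, map_mul, map_mul, AlgEquiv.apply_symm_apply,
      AlgEquiv.apply_symm_apply]
  have hsimple : ∀ J : Ideal (R ⧸ Iq), J ≠ ⊥ → (∀ i, ∀ u ∈ J, E i u ∈ J) → J = ⊤ := by
    intro J hJ hstab
    set J' : Ideal (TruncPoly.Alg κ p n) := J.comap Φ with hJ'
    have hJ'ne : J' ≠ ⊥ := by
      obtain ⟨v, hvJ, hv0⟩ := J.ne_bot_iff.mp hJ
      rw [Ne, Ideal.ext_iff, not_forall] -- placeholder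
      refine ⟨Φ.symm v, fun h => hv0 ?_⟩
      have : Φ.symm v ∈ J' := by
        change Φ (Φ.symm v) ∈ J
        rw [AlgEquiv.apply_symm_apply]; exact hvJ
      have h0 : Φ.symm v = 0 := by simpa [Ideal.mem_bot] using (h.mp this)
      rw [← AlgEquiv.apply_symm_apply Φ v, h0, map_zero]
    have hJ'stab : ∀ i, ∀ u ∈ J', TruncPoly.D κ p n i u ∈ J' := by
      intro i u hu
      change Φ (TruncPoly.D κ p n i u) ∈ J
      have := hstab i (Φ u) hu
      simpa only [E, AlgEquiv.symm_apply_apply] using this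
    have hJ'top := TruncPoly.ideal_eq_top_of_forall_D_mem J' hJ'ne hJ'stab
    rw [eq_top_iff]
    intro v _
    have : Φ.symm v ∈ J' := hJ'top ▸ Submodule.mem_top
    change Φ (Φ.symm v) ∈ J at this
    rwa [AlgEquiv.apply_symm_apply] at this
  -- `𝔫_A P` is a proper ideal; the differential step
  have hJtop : (maximalIdeal A).map A.subtype ≠ ⊤ := fun h =>
    (maximalIdeal.isMaximal (R ⧸ Iq)).ne_top (top_le_iff.mp (h ▸ hmAmap_le))
  have hfun2 : (⇑(frobenius R p) ∘ x) = fun i => x i ^ p ^ 1 := by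
    funext i
    simp [frobenius_def]
  have hIq_frob : (Ideal.span (Set.range x)).map (frobenius R p) = Iq := by
    rw [Ideal.map_span, ← Set.range_comp, hfun2]
  -- `κ`-derivations of `A` from the transported partial derivatives; Harper's theorem
  have hEκ : ∀ i (c : κ), E i (algebraMap κ (R ⧸ Iq) c) = 0 := by
    intro i c
    simp only [E]
    rw [Φ.symm.commutes c, TruncPoly.D_algebraMap, map_zero]
  have hDS : ∀ I : Ideal A, I ≠ ⊥ → I ≠ ⊤ → ∃ δ : A → A, (∀ b c, δ (b + c) = δ b + δ c) ∧
      (∀ b c, δ (b * c) = b * δ c + c * δ b) ∧ (∀ c : κ, δ (algebraMap κ A c) = 0) ∧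
      ∃ b ∈ I, δ b ∉ I := fun I hI0 hI1 =>
    exists_derivation_of_dsimple A bP E hEadd hEmul hEκ hsimple I hI0 hI1
  have h1A : ∀ a : A, ∃ c : κ, a - algebraMap κ A c ∈ maximalIdeal A := fun a =>
    ⟨residue A a, by
      rw [← IsLocalRing.residue_eq_zero_iff, map_sub]
      change residue A a - residue A (σ _) = 0
      rw [hσ, sub_self]⟩
  have hnil : ∀ a ∈ maximalIdeal A, a ^ p = 0 := by
    intro a ha
    obtain ⟨y, hy⟩ := hψ_surjA a
    have hya : (⟨ψ y, ⟨y, rfl⟩⟩ : A) = a := Subtype.ext hy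
    have hym : y ∈ maximalIdeal R' := (hmA' y).mp (by rw [hya]; exact ha)
    apply Subtype.ext
    rw [SubmonoidClass.coe_pow, ZeroMemClass.coe_zero, ← hy, hψ_apply, ← map_pow,
      Ideal.Quotient.eq_zero_iff_mem, ← hIq_frob]
    have hyR : (y : R) ∈ Ideal.span (Set.range x) := by
      rw [hx]; exact (mem_maximalIdeal_iff hR' y).mp hym
    have := Ideal.mem_map_of_mem (frobenius R p) hyR
    rwa [frobenius_def] at this
  obtain ⟨e, yA, hyA, hpe⟩ := hH A κ h1A hnil hDS
  -- `e < n` since `p^e · rank = p^n` and `R' ≠ R`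
  rw [← hpe] at hmul
  have hen : e < n := by
    by_contra hle
    push Not at hle
    have hdvd : p ^ e ∣ p ^ n := Dvd.intro _ hmul
    have hle' : e ≤ n := (Nat.pow_dvd_pow_iff_le_right hp'.one_lt).mp hdvd
    have heq : e = n := le_antisymm hle' hle
    rw [heq] at hmul
    apply hne
    apply eq_top_of_finrank_eq_one hR'
    have : p ^ n * Module.finrank R' R = p ^ n * 1 := by rw [hmul, mul_one]
    exact Nat.eq_of_mul_eq_mul_left (pow_pos hp'.pos n) this
  -- lift the generators of `𝔫_A` to `𝔪'`: `𝔪' ⊆ (t₁, …, t_e) + 𝔮`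
  choose t ht using fun k => hψ_surjA (yA k)
  have htA : ∀ k, (⟨ψ (t k), ⟨t k, rfl⟩⟩ : A) = yA k := fun k => Subtype.ext (ht k)
  have htm : ∀ k, t k ∈ maximalIdeal R' := fun k => (hmA' (t k)).mp (by
    rw [htA, ← hyA]; exact Ideal.subset_span ⟨k, rfl⟩)
  have hclaim : ∀ s ∈ maximalIdeal R', s ∈ Ideal.span (Set.range t) ⊔ 𝔮 := by
    intro s hs
    have hsa : (⟨ψ s, ⟨s, rfl⟩⟩ : A) ∈ Ideal.span (Set.range yA) := by rw [hyA]; exact (hmA' s).mpr hs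
    rw [Ideal.mem_span_range_iff_exists_fun] at hsa
    obtain ⟨c, hc⟩ := hsa
    choose d hd using fun k => hψ_surjA (c k)
    have hmem : s - ∑ k, d k * t k ∈ 𝔮 := by
      rw [← hker, map_sub, map_sum, sub_eq_zero]
      have := congrArg Subtype.val hc
      rw [AddSubmonoidClass.coe_finsetSum] at this
      change ∑ k, ((c k * yA k : A) : R ⧸ Iq) = ψ s at this
      rw [← this]
      refine Finset.sum_congr rfl fun k _ => ?_
      rw [Subring.coe_mul, map_mul, hd, ht]
    have : s = (∑ k, d k * t k) + (s - ∑ k, d k * t k) := by ring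
    rw [this]
    exact Submodule.add_mem_sup
      (Ideal.sum_mem _ fun k _ => Ideal.mul_mem_left _ _ (Ideal.subset_span ⟨k, rfl⟩)) hmem
  -- final count: `𝔪'` needs `n` generators
  by_contra hall
  push Not at hall
  have h𝔮le : 𝔮 ≤ maximalIdeal R' ^ 2 := by
    rw [h𝔮, Ideal.span_le]
    rintro _ ⟨i, rfl⟩
    exact hall (x i) (hxm i)
  have hm'le : maximalIdeal R' ≤ Ideal.span (Set.range t) ⊔ maximalIdeal R' • maximalIdeal R' := by
    intro s hs
    obtain ⟨u, hu, v, hv, rfl⟩ := Submodule.mem_sup.mp (hclaim s hs)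
    refine Submodule.add_mem_sup hu ?_
    have := h𝔮le hv
    rwa [pow_two] at this
  have hNak := Submodule.le_of_le_smul_of_le_jacobson_bot (IsNoetherian.noetherian _)
    (IsLocalRing.maximalIdeal_le_jacobson _) hm'le
  have hsf : (maximalIdeal R').spanFinrank ≤ e := by
    have heq : maximalIdeal R' = Ideal.span (Set.range t) :=
      le_antisymm hNak (Ideal.span_le.mpr (by rintro _ ⟨k, rfl⟩; exact htm k))
    rw [heq]
    calc (Ideal.span (Set.range t)).spanFinrank ≤ (Set.range t).ncard :=
          Submodule.spanFinrank_span_le_ncard_of_finite (Set.finite_range t)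
      _ ≤ e := by
        classical
        rw [show Set.range t = ↑(Finset.univ.image t) by simp, Set.ncard_coe_finset]
        exact Finset.card_image_le.trans (by simp)
  have hdimR' : (maximalIdeal R').spanFinrank = n := by
    have e1 := IsRegularLocalRing.spanFinrank_maximalIdeal (R := R')
    have e2 := IsRegularLocalRing.spanFinrank_maximalIdeal (R := R)
    rw [ringKrullDim_eq hR', ← e2, hn] at e1
    exact_mod_cast e1
  omega

/-- **The Kimura–Niitsuma theorem (F-96h `KimuraNiitsuma1982_theorem`) from Harper's theorem alone**: the landed
assembly `kimuraNiitsuma1982_theorem_of_lemma5` fed with `lemma5_of_harper`. The remaining input `hH` is Harper's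
theorem on differentiably simple rings (L. Harper 1961; S. Yuan 1964 Cor. 2.8), in the consequence-form stated
there. [cite: KimuraNiitsuma1982, Theorem §3 p. 375; Lemma 5 p. 376] -/
theorem kimuraNiitsuma1982_theorem_of_harper
    (hH : ∀ (p : ℕ) [Fact p.Prime] (A : Type u) [CommRing A] [IsLocalRing A] [CharP A p] (κ : Type u) [Field κ]
      [Algebra κ A] [Module.Finite κ A],
      (∀ a : A, ∃ c : κ, a - algebraMap κ A c ∈ maximalIdeal A) →
      (∀ a ∈ maximalIdeal A, a ^ p = 0) →
      (∀ I : Ideal A, I ≠ ⊥ → I ≠ ⊤ → ∃ δ : A → A, (∀ b c, δ (b + c) = δ b + δ c) ∧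
          (∀ b c, δ (b * c) = b * δ c + c * δ b) ∧ (∀ c : κ, δ (algebraMap κ A c) = 0) ∧
          ∃ b ∈ I, δ b ∉ I) →
      ∃ (e : ℕ) (y : Fin e → A), Ideal.span (Set.range y) = maximalIdeal A ∧ p ^ e = Module.finrank κ A) :
    KimuraNiitsuma1982_theorem.{u} :=
  kimuraNiitsuma1982_theorem_of_lemma5 fun p _ _ _ _ _ _ hreg hR' _ hne hres _ =>
    lemma5_of_harper (hH p) hR' hreg hne hres

end RelativePBasis

end Literature.RingTheory.PBasis
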